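import Literature.Analysis.FluidPDE.DuchonRobertUniformDefect
import Literature.Analysis.FluidPDE.BallAverageLimits
import Literature.Analysis.FluidPDE.DuchonRobertLocalBalancePressureProofs
import Literature.Analysis.FluidPDE.DuchonRobertCubicIdentity
import Literature.Analysis.FunctionSpaces.TorusPeriodization
import Literature.Analysis.FunctionSpaces.TorusSpaceTimeConvolution
import Literature.Analysis.FunctionSpaces.TorusCommutatorEstimate
import HarnessLib

/-!
# Weak Euler solutions have uniform Duchon–Robert defects; the 4/3 law from Duchon–Robert's printed steps

Topic: Analysis/FluidPDE, proofs. Companion to `Literature.Analysis.FluidPDE.DuchonRobertUniformDefect`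
(the notion `Torus.HasUniformDuchonRobertDefect` and the theorem "uniform defect ⇒ local 4/3 law")
and to `Literature.Analysis.FluidPDE.DuchonRobertLocalBalance` (Duchon–Robert 2000, Prop. 1–2,
decomposed into named facts in the torus-kernel encoding `u^ε = u ⋆ K_ε`,
`K_ε = Torus.mollifierKernel φ ε`).

## Main results

* `Torus.hasUniformDuchonRobertDefect_of_steps`: granted Duchon–Robert's cubic identity
  (`Torus.integral_kernelFlux_mul_eq`) and the tested momentum equation
  (`Torus.IsDistributionalNSSolutionOn.symmTestField_identity`), every distributional Euler
  solution `(u, p)` on `T^d × (0,T)` with `u ∈ L³`, `p ∈ L^{3/2}` has the local energy flux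
  `ψ ↦ ∫₀ᵀ∫ [½|u|²∂ₜψ + (½|u|² + p)⟪u,∇ψ⟫]` as a **uniform** Duchon–Robert defect: the
  convergence `∫₀ᵀ∫ D_ε^φ(u) ψ → D(u)(ψ)` of Duchon–Robert's Prop. 2 holds uniformly over all
  mollifiers `φ` supported in the unit ball.
* `Torus.hasFourThirdsLaw_of_steps`: the accepted named fact
  `Torus.HasDuchonRobertDefect.hasFourThirdsLaw` (the *unconditional* local 4/3 law for `L³` weak
  Euler solutions, `DissipationAnomaly`) follows from those two facts and the pressure fact
  `Torus.exists_pressure_of_tendsto_L3` (`DuchonRobertInviscidLimit`; Calderón–Zygmund on `T^d`).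
  Its sources (Duchon–Robert 2000, §5; Eyink 2003, §1) print only the conditional law; this file
  and `DuchonRobertUniformDefect` show that the unconditional statement is nevertheless a
  consequence of the printed *proof* of Duchon–Robert's Prop. 2 (discrepancy record in
  `EyinkLocalFourFifths` / `DuchonRobertUniformDefect`). With the cubic identity discharged in the
  tree (`Torus.integral_kernelFlux_mul_eq_holds`, `DuchonRobertCubicIdentity`),
  `Torus.hasFourThirdsLaw_of_symmTestField_identity_of_pressure` leaves exactly the tested momentum
  equation and the pressure fact as hypotheses.

## Proof architecture

For a unit-ball mollifier `φ`, `ε > 0` and a test function `ψ` (all integrals over `(0,T) × T^d`,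
`K = K_ε`, `g = ⟪u,∇ψ⟫`):

1. *The identity at scale `ε`* (as in `Torus.duchon_robert_defect_exists_of`):
   `4∫∫D_εψ = ∫∫𝒟_Kψ` (`four_mul_duchonRobertApprox_eq_kernelFlux`)
   `= A₁ − A₂ + 2A₃ + 2(A₅ + A₆)` with `A₁ = ∫∫⟪(|u|²u)⋆K, ∇ψ⟫`, `A₂ = ∫∫(|u|²⋆K) g`,
   `A₃ = ∫∫⟪u,u⋆K⟫ g`, `A₅ = ∫∫⟪u,u⋆K⟫∂ₜψ`, `A₆ = ∫∫ p div Φ`, `Φ = ψ(u⋆K) + (ψu)⋆K`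
   (cubic identity, tested momentum equation with `ν = 0`).
2. *The pressure pairing*: `div Φ = ⟪u⋆K, ∇ψ⟫ + g⋆K` (`Torus.divergence_symmTestField` of
   `DuchonRobertLocalBalancePressureProofs`; here also `divergence_vecConv_eq_zero`,
   `divergence_vecConv_smul`: weak divergence-freeness tested with `K(x − ·)`, `ψ K(x − ·)`), and `∫ p (g⋆K) = ∫ (p⋆K) g` (evenness of `K`,
   `Torus.integral_mul_convolution_comm`), so `A₆ = ∫∫p⟪u⋆K,∇ψ⟫ + ∫∫(p⋆K) g`.
3. *The estimate* (`ofReal_abs_duchonRobert_sub_flux_le`): subtracting the limit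
   `∫∫[½|u|²∂ₜψ + (½|u|²+p)g] = ¼(A₀ − A₀ + 2A₀ + 2(T₀ + 2P₀))`, each difference is a mollification
   deviation paired with fixed factors, bounded by Hölder `3/2·3` or Cauchy–Schwarz:
   `|∫∫D_εψ − D(u)(ψ)| ≤ ¼[C₂‖w⋆K − w‖₁ + C₂‖s⋆K − s‖_{3/2}‖u‖₃ + 2C₂‖u‖₃²‖u⋆K − u‖₃
    + 2(C₁‖u‖₂‖u⋆K − u‖₂ + C₂‖p‖_{3/2}‖u⋆K − u‖₃ + C₂‖p⋆K − p‖_{3/2}‖u‖₃)]`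
   (`w = |u|²u`, `s = |u|²`, `C₁ = sup|∂ₜψ|`, `C₂ = sup|∇ψ|`).
4. *Uniformity* (`exists_forall_lintegral_kernelAverage_sub_rpow_le`): for `f ∈ L^q((0,T) × T^d)`,
   `‖f⋆K_ε − f‖_q → 0` as `ε → 0⁺` **uniformly over unit-ball `φ`** — the bridge
   `(f ⋆ K_ε)(x) = ∫_{ℝ^d} φ^ε(ξ) f(x + πξ) dξ` (`convolution_mollifierKernel_apply`,
   `vecConv_mollifierKernel_apply`: periodisation unfolding), Jensen's inequality for the
   probability kernel `φ^ε dξ` (`lintegral_mul_rpow_le_lintegral_mul_rpow`), Tonelli, and the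
   continuity of translation in `L^q((0,T) × T^d)` (the tree's `Torus.tendsto_lintegral_translate_sub`,
   `BallAverageLimits`), since `φ^ε` is supported in the ball of radius `ε`.
5. *Assembly*: the bound of step 3 with all deviations `≤ τ` tends to `0` with `τ`
   (`tendsto_scaleBound`); choose `τ`, then the five thresholds of step 4.

## Design notes

* No definitions: statements use the tree's `⋆ mollifierKernel φ ε` / `Torus.vecConv`;
  the Euclidean kernel average `∫ φ^ε(ξ) f(x + πξ) dξ` appears only inside proved bridge and
  estimate lemmas (as agreed in the review of the superseded proposal of a second encoding).
* `L^q` exponents are real (`rpow`) throughout the deviation bookkeeping (`q = 3, 2, 3/2, 1`).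
* Everything is proved; the trust base of `hasFourThirdsLaw_of_steps` is exactly the three named
  facts it takes as hypotheses.

## References

* J. Duchon, R. Robert, *Inertial energy dissipation for weak solutions of incompressible Euler
  and Navier–Stokes equations*, Nonlinearity 13 (2000) 249–255, Prop. 2 and its proof
  (pp. 250–251), §5. [DuchonRobert2000]
* G. L. Eyink, *Local 4/5-law and energy dissipation anomaly in turbulence*, Nonlinearity 16
  (2003) 137–145 = arXiv:nlin/0208004, §1 (1.5)–(1.6); §2, proof of Thm. 1 (PDF pp. 4–5: the
  balance equations (uuL-eq)/(uuT-eq), and "`‖u(·+ℓ) − u‖_{L³} → 0` … hence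
  `‖u_L^ε − ⅓u‖_{L³} → 0`", the translation-continuity mechanism of step 4). [Eyink2003]
* L. C. Evans, *Partial Differential Equations*, 2nd ed. (2010), App. C.4, Thm. 7 (mollifiers).
  [Evans2010]
-/

noncomputable section

open MeasureTheory MeasureTheory.Measure TopologicalSpace Set Function Filter Topology Metric Module
open scoped InnerProductSpace RealInnerProductSpace ENNReal NNReal Convolution

namespace Literature.Analysis.FluidPDE.Torus

variable {d : Type*} [Fintype d]


/-! ## Kernel mollification: integrability of the integrand, the difference formula -/

section KernelBasics

variable {F : Type*} [NormedAddCommGroup F] [NormedSpace ℝ F]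

/-- The rescaled unit-ball mollifier vanishes outside the closed ball of radius `ε`. [folklore] -/
theorem IsUnitBallMollifier.mollifierScale_eq_zero {φ : EuclideanSpace ℝ d → ℝ} (hφ : IsUnitBallMollifier φ)
    {ε : ℝ} (hε : 0 < ε) {ξ : EuclideanSpace ℝ d} (hξ : ε < ‖ξ‖) :
    FluidPDE.mollifierScale ε φ ξ = 0 := by
  rw [FluidPDE.mollifierScale_apply, hφ.2 _ ?_, mul_zero]
  rw [norm_smul, norm_inv, Real.norm_eq_abs, abs_of_pos hε]
  rwa [lt_inv_mul_iff₀ hε, mul_one]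

/-- The rescaled unit-ball mollifier is supported in the closed ball of radius `ε`. [folklore] -/
theorem IsUnitBallMollifier.support_mollifierScale_subset {φ : EuclideanSpace ℝ d → ℝ}
    (hφ : IsUnitBallMollifier φ) {ε : ℝ} (hε : 0 < ε) :
    support (FluidPDE.mollifierScale ε φ) ⊆ closedBall 0 ε := fun ξ hξ => by
  rw [mem_closedBall, dist_zero_right]
  by_contra h
  exact hξ (hφ.mollifierScale_eq_zero hε (not_le.1 h))

/-- **Integrability of the mollification integrand**: for `f ∈ L¹(T^d)`, a unit-ball mollifier
`φ` and `ε > 0`, `ξ ↦ φ^ε(ξ) f(x + π ξ)` is integrable on `ℝ^d` at every `x` (the kernel is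
bounded with support in the ball of radius `ε`, and the lift of an integrable function is
integrable on bounded sets, `Torus.integrableOn_lift_of_subset_closedBall`). [folklore] -/
theorem integrable_mollifierScale_smul_translate [DecidableEq d] {φ : EuclideanSpace ℝ d → ℝ}
    (hφ : IsUnitBallMollifier φ) {ε : ℝ} (hε : 0 < ε) {f : UnitAddTorus d → F}
    (hf : Integrable f volume) (x : UnitAddTorus d) :
    Integrable (fun ξ => FluidPDE.mollifierScale ε φ ξ • f (x + FunctionSpaces.Torus.proj ξ)) volume := by
  have hfx : Integrable (fun y => f (x + y)) volume := hf.comp_add_left x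
  have hlift : IntegrableOn (FunctionSpaces.Torus.lift fun y => f (x + y)) (closedBall 0 ε) volume :=
    FunctionSpaces.Torus.integrableOn_lift_of_subset_closedBall hfx Subset.rfl
  have hcont : Continuous (FluidPDE.mollifierScale ε φ) :=
    (hφ.1.mollifierScale hε).1.continuous
  have hK : IntegrableOn (fun ξ => FluidPDE.mollifierScale ε φ ξ • f (x + FunctionSpaces.Torus.proj ξ))
      (closedBall 0 ε) volume :=
    hlift.continuousOn_smul hcont.continuousOn (isCompact_closedBall _ _)
  refine hK.integrable_of_forall_notMem_eq_zero fun ξ hξ => ?_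
  rw [hφ.mollifierScale_eq_zero hε (by simpa [dist_zero_right] using hξ), zero_smul]

/-- **The difference formula**: `(φ^ε ∗ f)(x) − f(x) = ∫ φ^ε(ξ) (f(x + π ξ) − f(x)) dξ` for
`f ∈ L¹(T^d)`, a unit-ball mollifier `φ` and `ε > 0` (unit mass of `φ^ε`). [folklore] -/
theorem kernelAverage_sub_eq [DecidableEq d] [CompleteSpace F] {φ : EuclideanSpace ℝ d → ℝ}
    (hφ : IsUnitBallMollifier φ) {ε : ℝ} (hε : 0 < ε) {f : UnitAddTorus d → F}
    (hf : Integrable f volume) (x : UnitAddTorus d) :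
    (∫ ξ, FluidPDE.mollifierScale ε φ ξ • f (x + FunctionSpaces.Torus.proj ξ)) - f x =
      ∫ ξ, FluidPDE.mollifierScale ε φ ξ • (f (x + FunctionSpaces.Torus.proj ξ) - f x) := by
  have h1 := integrable_mollifierScale_smul_translate hφ hε hf x
  have h2 : Integrable (fun ξ => FluidPDE.mollifierScale ε φ ξ • f x) volume :=
    ((hφ.1.mollifierScale hε).1.continuous.integrable_of_hasCompactSupport
      (hφ.1.mollifierScale hε).2.1).smul_const _
  simp only [smul_sub]
  rw [integral_sub h1 h2, integral_smul_const, FluidPDE.integral_mollifierScale hφ.1 hε, one_smul]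

/-- Pointwise bound: `‖(φ^ε ∗ f)(x) − f(x)‖ₑ ≤ ∫⁻ φ^ε(ξ) ‖f(x + π ξ) − f(x)‖ₑ dξ`. [folklore] -/
theorem enorm_kernelAverage_sub_le [DecidableEq d] [CompleteSpace F] {φ : EuclideanSpace ℝ d → ℝ}
    (hφ : IsUnitBallMollifier φ) {ε : ℝ} (hε : 0 < ε) {f : UnitAddTorus d → F}
    (hf : Integrable f volume) (x : UnitAddTorus d) :
    ‖(∫ ξ, FluidPDE.mollifierScale ε φ ξ • f (x + FunctionSpaces.Torus.proj ξ)) - f x‖ₑ ≤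
      ∫⁻ ξ, ENNReal.ofReal (FluidPDE.mollifierScale ε φ ξ) * ‖f (x + FunctionSpaces.Torus.proj ξ) - f x‖ₑ := by
  rw [kernelAverage_sub_eq hφ hε hf x]
  refine (enorm_integral_le_lintegral_enorm _).trans (lintegral_mono fun ξ => ?_)
  rw [enorm_smul, Real.enorm_eq_ofReal ((hφ.1.mollifierScale hε).2.2.2.1 ξ)]

/-- Pointwise bound: `‖(φ^ε ∗ f)(x)‖ₑ ≤ ∫⁻ φ^ε(ξ) ‖f(x + π ξ)‖ₑ dξ`. [folklore] -/
theorem enorm_kernelAverage_le {φ : EuclideanSpace ℝ d → ℝ} (hφ : IsUnitBallMollifier φ) {ε : ℝ}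
    (hε : 0 < ε) (f : UnitAddTorus d → F) (x : UnitAddTorus d) :
    ‖(∫ ξ, FluidPDE.mollifierScale ε φ ξ • f (x + FunctionSpaces.Torus.proj ξ))‖ₑ ≤
      ∫⁻ ξ, ENNReal.ofReal (FluidPDE.mollifierScale ε φ ξ) * ‖f (x + FunctionSpaces.Torus.proj ξ)‖ₑ := by
  refine (enorm_integral_le_lintegral_enorm _).trans (lintegral_mono fun ξ => ?_)
  rw [enorm_smul, Real.enorm_eq_ofReal ((hφ.1.mollifierScale hε).2.2.2.1 ξ)]

/-- The rescaled mollifier has unit lower integral: `∫⁻ φ^ε = 1`. [folklore] -/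
theorem lintegral_ofReal_mollifierScale {φ : EuclideanSpace ℝ d → ℝ} (hφ : FluidPDE.IsMollifier φ)
    {ε : ℝ} (hε : 0 < ε) :
    ∫⁻ ξ, ENNReal.ofReal (FluidPDE.mollifierScale ε φ ξ) = 1 := by
  have h := hφ.mollifierScale hε
  rw [← ofReal_integral_eq_lintegral_ofReal (h.1.continuous.integrable_of_hasCompactSupport h.2.1)
    (ae_of_all _ h.2.2.2.1), FluidPDE.integral_mollifierScale hφ hε, ENNReal.ofReal_one]

end KernelBasics

/-! ## Jensen's inequality for a probability kernel -/

section Jensen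

/-- **Jensen's inequality for a probability kernel** in `ℝ≥0∞`: if `∫⁻ w = 1` and `q ≥ 1`, then
`(∫⁻ w G)^q ≤ ∫⁻ w G^q` (Hölder with exponents `q/(q−1)`, `q` on `w^{1−1/q} · (w^{1/q} G)`). [folklore] -/
theorem lintegral_mul_rpow_le_lintegral_mul_rpow {α : Type*} [MeasurableSpace α] {ν : Measure α}
    {w G : α → ℝ≥0∞} (hw : AEMeasurable w ν) (hG : AEMeasurable G ν) (hw1 : ∫⁻ a, w a ∂ν = 1)
    {q : ℝ} (hq : 1 ≤ q) :
    (∫⁻ a, w a * G a ∂ν) ^ q ≤ ∫⁻ a, w a * G a ^ q ∂ν := by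
  rcases hq.eq_or_lt with rfl | hq1
  · simp
  have hq0 : 0 < q := one_pos.trans hq1
  have hqne : q ≠ 0 := hq0.ne'
  have hpq : Real.HolderConjugate (q / (q - 1)) q :=
    ((Real.holderConjugate_iff_eq_conjExponent hq1).2 rfl).symm
  set f : α → ℝ≥0∞ := fun a => w a ^ (1 - q⁻¹) with hf
  set g : α → ℝ≥0∞ := fun a => w a ^ q⁻¹ * G a with hg
  have hfm : AEMeasurable f ν := hw.pow_const _
  have hgm : AEMeasurable g ν := (hw.pow_const _).mul hG
  have hfg : ∀ a, w a * G a = f a * g a := fun a => by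
    simp only [hf, hg]
    rw [← mul_assoc, ← ENNReal.rpow_add_of_nonneg _ _ (by rw [sub_nonneg]; exact inv_le_one_of_one_le₀ hq)
      (inv_nonneg.2 hq0.le), sub_add_cancel, ENNReal.rpow_one]
  have h := ENNReal.lintegral_mul_le_Lp_mul_Lq ν hpq hfm hgm
  -- identify the two factors
  have hf' : ∀ a, f a ^ (q / (q - 1)) = w a := fun a => by
    simp only [hf]
    rw [← ENNReal.rpow_mul, show (1 - q⁻¹) * (q / (q - 1)) = 1 by field_simp, ENNReal.rpow_one]
  have hg' : ∀ a, g a ^ q = w a * G a ^ q := fun a => by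
    simp only [hg]
    rw [ENNReal.mul_rpow_of_nonneg _ _ hq0.le, ENNReal.rpow_inv_rpow hqne]
  simp only [Pi.mul_apply, hf', hg', hw1, ENNReal.one_rpow, one_mul] at h
  calc (∫⁻ a, w a * G a ∂ν) ^ q = (∫⁻ a, f a * g a ∂ν) ^ q := by simp_rw [hfg]
    _ ≤ ((∫⁻ a, w a * G a ^ q ∂ν) ^ (1 / q)) ^ q := ENNReal.rpow_le_rpow h hq0.le
    _ = ∫⁻ a, w a * G a ^ q ∂ν := by rw [one_div, ENNReal.rpow_inv_rpow hqne]

end Jensen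


/-! ## `L^q` bounds for kernel mollification on `(0,T) × T^d` -/

section KernelLq

variable {T : ℝ} {F : Type*} [NormedAddCommGroup F]

/-- Translation invariance with a real exponent: `∫∫ ‖f(t, x + a)‖^q = ∫∫ ‖f‖^q`. [folklore] -/
theorem lintegral_translate_enorm_rpow {f : ℝ → UnitAddTorus d → F}
    (a : UnitAddTorus d) (q : ℝ) :
    ∫⁻ z, ‖f z.1 (z.2 + a)‖ₑ ^ q ∂((volume.restrict (Ioo 0 T)).prod volume) =
      ∫⁻ z, ‖uncurry f z‖ₑ ^ q ∂((volume.restrict (Ioo 0 T)).prod volume) := by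
  have hmp : MeasurePreserving (Prod.map id fun x : UnitAddTorus d => x + a)
      (((volume : Measure ℝ).restrict (Ioo 0 T)).prod volume) (((volume : Measure ℝ).restrict (Ioo 0 T)).prod volume) :=
    (MeasurePreserving.id _).prod (measurePreserving_add_right volume a)
  have hemb : MeasurableEmbedding (Prod.map id fun x : UnitAddTorus d => x + a) :=
    (MeasurableEquiv.prodCongr (MeasurableEquiv.refl ℝ) (MeasurableEquiv.addRight a)).measurableEmbedding
  exact hmp.lintegral_comp_emb hemb (fun z => ‖uncurry f z‖ₑ ^ q)

/-- Joint measurability of the translated field `((t,x), ξ) ↦ f(t, x + π ξ)`. [folklore] -/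
theorem aestronglyMeasurable_translate_proj {f : ℝ → UnitAddTorus d → F}
    (hf : AEStronglyMeasurable (uncurry f) ((volume.restrict (Ioo 0 T)).prod volume)) :
    AEStronglyMeasurable (fun q : (ℝ × UnitAddTorus d) × EuclideanSpace ℝ d =>
        f q.1.1 (q.1.2 + FunctionSpaces.Torus.proj q.2))
      (((volume.restrict (Ioo 0 T)).prod volume).prod volume) :=
  aestronglyMeasurable_translate (ν := volume) hf FunctionSpaces.Torus.measurable_proj

/-- The rescaled mollifier as a measurable `ℝ≥0∞`-valued weight. [folklore] -/
theorem measurable_ofReal_mollifierScale {φ : EuclideanSpace ℝ d → ℝ} (hφ : FluidPDE.IsMollifier φ)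
    {ε : ℝ} (hε : 0 < ε) :
    Measurable fun ξ : EuclideanSpace ℝ d => ENNReal.ofReal (FluidPDE.mollifierScale ε φ ξ) :=
  ENNReal.measurable_ofReal.comp (hφ.mollifierScale hε).1.continuous.measurable

variable [NormedSpace ℝ F]

/-- **Measurability of kernel mollifications** on `(0,T) × T^d` (a parametric Bochner integral of
a jointly measurable integrand). [folklore] -/
theorem aestronglyMeasurable_kernelAverage {φ : EuclideanSpace ℝ d → ℝ} {ε : ℝ}
    (hφc : Continuous (FluidPDE.mollifierScale ε φ)) {f : ℝ → UnitAddTorus d → F}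
    (hf : AEStronglyMeasurable (uncurry f) ((volume.restrict (Ioo 0 T)).prod volume)) :
    AEStronglyMeasurable (fun z : ℝ × UnitAddTorus d => (∫ ξ, FluidPDE.mollifierScale ε φ ξ • f z.1 (z.2 + FunctionSpaces.Torus.proj ξ)))
      ((volume.restrict (Ioo 0 T)).prod volume) := by
  have h : AEStronglyMeasurable (fun q : (ℝ × UnitAddTorus d) × EuclideanSpace ℝ d =>
      FluidPDE.mollifierScale ε φ q.2 • f q.1.1 (q.1.2 + FunctionSpaces.Torus.proj q.2))
      (((volume.restrict (Ioo 0 T)).prod volume).prod volume) :=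
    (hφc.comp_aestronglyMeasurable measurable_snd.aestronglyMeasurable).smul
      (aestronglyMeasurable_translate_proj hf)
  exact h.integral_prod_right'

/-- **Jensen–Tonelli bound for the mollification error**: for a unit-ball mollifier `φ`, `ε > 0`,
`q ≥ 1` and `f` jointly measurable with integrable slices,
`∫∫ ‖f^ε − f‖^q ≤ ∫ φ^ε(ξ) (∫∫ ‖f(t, x + π ξ) − f(t,x)‖^q) dξ`. [folklore] -/
theorem lintegral_enorm_kernelAverage_sub_rpow_le [DecidableEq d] [CompleteSpace F]
    {φ : EuclideanSpace ℝ d → ℝ} (hφ : IsUnitBallMollifier φ) {ε : ℝ} (hε : 0 < ε)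
    {f : ℝ → UnitAddTorus d → F}
    (hf : AEStronglyMeasurable (uncurry f) ((volume.restrict (Ioo 0 T)).prod volume))
    (hfi : ∀ᵐ t ∂(volume.restrict (Ioo 0 T)), Integrable (f t) volume) {q : ℝ} (hq : 1 ≤ q) :
    ∫⁻ z, ‖(∫ ξ, FluidPDE.mollifierScale ε φ ξ • f z.1 (z.2 + FunctionSpaces.Torus.proj ξ)) - f z.1 z.2‖ₑ ^ q ∂((volume.restrict (Ioo 0 T)).prod volume) ≤
      ∫⁻ ξ, ENNReal.ofReal (FluidPDE.mollifierScale ε φ ξ) *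
        ∫⁻ z, ‖f z.1 (z.2 + FunctionSpaces.Torus.proj ξ) - f z.1 z.2‖ₑ ^ q
          ∂((volume.restrict (Ioo 0 T)).prod volume) := by
  have hq0 : 0 ≤ q := zero_le_one.trans hq
  have hwm := measurable_ofReal_mollifierScale hφ.1 hε
  have hw1 : ∫⁻ ξ, ENNReal.ofReal (FluidPDE.mollifierScale ε φ ξ) = 1 := lintegral_ofReal_mollifierScale hφ.1 hε
  -- the jointly measurable integrand
  have hDm : AEStronglyMeasurable (fun p : (ℝ × UnitAddTorus d) × EuclideanSpace ℝ d =>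
      f p.1.1 (p.1.2 + FunctionSpaces.Torus.proj p.2) - f p.1.1 p.1.2)
      (((volume.restrict (Ioo 0 T)).prod volume).prod volume) :=
    (aestronglyMeasurable_translate_proj hf).sub hf.comp_fst
  -- pointwise Jensen at a.e. `z`
  have hae : ∀ᵐ z ∂((volume.restrict (Ioo 0 T)).prod volume), Integrable (f z.1) (volume : Measure (UnitAddTorus d)) :=
    (quasiMeasurePreserving_fst (μ := volume.restrict (Ioo 0 T))
      (ν := (volume : Measure (UnitAddTorus d)))).ae hfi
  have hsec : ∀ᵐ z ∂((volume.restrict (Ioo 0 T)).prod volume), AEStronglyMeasurable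
      (fun ξ => f z.1 (z.2 + FunctionSpaces.Torus.proj ξ) - f z.1 z.2) volume := hDm.prodMk_left
  have hpt : ∀ᵐ z ∂((volume.restrict (Ioo 0 T)).prod volume),
      ‖(∫ ξ, FluidPDE.mollifierScale ε φ ξ • f z.1 (z.2 + FunctionSpaces.Torus.proj ξ)) - f z.1 z.2‖ₑ ^ q ≤
        ∫⁻ ξ, ENNReal.ofReal (FluidPDE.mollifierScale ε φ ξ) *
          ‖f z.1 (z.2 + FunctionSpaces.Torus.proj ξ) - f z.1 z.2‖ₑ ^ q := by
    filter_upwards [hae, hsec] with z hz hzm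
    exact (ENNReal.rpow_le_rpow (enorm_kernelAverage_sub_le hφ hε hz z.2) hq0).trans
      (lintegral_mul_rpow_le_lintegral_mul_rpow hwm.aemeasurable hzm.enorm hw1 hq)
  -- Tonelli
  have hWG : AEMeasurable (uncurry fun (z : ℝ × UnitAddTorus d) (ξ : EuclideanSpace ℝ d) =>
      ENNReal.ofReal (FluidPDE.mollifierScale ε φ ξ) *
        ‖f z.1 (z.2 + FunctionSpaces.Torus.proj ξ) - f z.1 z.2‖ₑ ^ q)
      (((volume.restrict (Ioo 0 T)).prod volume).prod volume) :=
    (hwm.comp_aemeasurable measurable_snd.aemeasurable).mul (hDm.enorm.pow_const q)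
  refine (lintegral_mono_ae hpt).trans ?_
  rw [lintegral_lintegral_swap hWG]
  refine le_of_eq (lintegral_congr fun ξ => ?_)
  exact lintegral_const_mul'' _ (((aestronglyMeasurable_uncurry_comp_add hf _).sub hf).enorm.pow_const q)

/-- **Jensen–Tonelli bound for the mollification**: `∫∫ ‖f^ε‖^q ≤ ∫∫ ‖f‖^q` for a unit-ball
mollifier, `ε > 0`, `q ≥ 1` (unit mass and translation invariance). [folklore] -/
theorem lintegral_enorm_kernelAverage_rpow_le [DecidableEq d]
    {φ : EuclideanSpace ℝ d → ℝ} (hφ : IsUnitBallMollifier φ) {ε : ℝ} (hε : 0 < ε)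
    {f : ℝ → UnitAddTorus d → F}
    (hf : AEStronglyMeasurable (uncurry f) ((volume.restrict (Ioo 0 T)).prod volume))
    {q : ℝ} (hq : 1 ≤ q) :
    ∫⁻ z, ‖(∫ ξ, FluidPDE.mollifierScale ε φ ξ • f z.1 (z.2 + FunctionSpaces.Torus.proj ξ))‖ₑ ^ q ∂((volume.restrict (Ioo 0 T)).prod volume) ≤
      ∫⁻ z, ‖uncurry f z‖ₑ ^ q ∂((volume.restrict (Ioo 0 T)).prod volume) := by
  have hq0 : 0 ≤ q := zero_le_one.trans hq
  have hwm := measurable_ofReal_mollifierScale hφ.1 hε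
  have hw1 : ∫⁻ ξ, ENNReal.ofReal (FluidPDE.mollifierScale ε φ ξ) = 1 := lintegral_ofReal_mollifierScale hφ.1 hε
  have hDm := aestronglyMeasurable_translate_proj hf
  have hsec : ∀ᵐ z ∂((volume.restrict (Ioo 0 T)).prod volume), AEStronglyMeasurable
      (fun ξ => f z.1 (z.2 + FunctionSpaces.Torus.proj ξ)) volume := hDm.prodMk_left
  have hpt : ∀ᵐ z ∂((volume.restrict (Ioo 0 T)).prod volume),
      ‖(∫ ξ, FluidPDE.mollifierScale ε φ ξ • f z.1 (z.2 + FunctionSpaces.Torus.proj ξ))‖ₑ ^ q ≤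
        ∫⁻ ξ, ENNReal.ofReal (FluidPDE.mollifierScale ε φ ξ) *
          ‖f z.1 (z.2 + FunctionSpaces.Torus.proj ξ)‖ₑ ^ q := by
    filter_upwards [hsec] with z hzm
    exact (ENNReal.rpow_le_rpow (enorm_kernelAverage_le hφ hε (f z.1) z.2) hq0).trans
      (lintegral_mul_rpow_le_lintegral_mul_rpow hwm.aemeasurable hzm.enorm hw1 hq)
  have hWG : AEMeasurable (uncurry fun (z : ℝ × UnitAddTorus d) (ξ : EuclideanSpace ℝ d) =>
      ENNReal.ofReal (FluidPDE.mollifierScale ε φ ξ) * ‖f z.1 (z.2 + FunctionSpaces.Torus.proj ξ)‖ₑ ^ q)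
      (((volume.restrict (Ioo 0 T)).prod volume).prod volume) :=
    (hwm.comp_aemeasurable measurable_snd.aemeasurable).mul (hDm.enorm.pow_const q)
  refine (lintegral_mono_ae hpt).trans (le_of_eq ?_)
  rw [lintegral_lintegral_swap hWG]
  calc ∫⁻ ξ, ∫⁻ z, ENNReal.ofReal (FluidPDE.mollifierScale ε φ ξ) *
          ‖f z.1 (z.2 + FunctionSpaces.Torus.proj ξ)‖ₑ ^ q ∂((volume.restrict (Ioo 0 T)).prod volume)
      = ∫⁻ ξ, ENNReal.ofReal (FluidPDE.mollifierScale ε φ ξ) *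
          ∫⁻ z, ‖uncurry f z‖ₑ ^ q ∂((volume.restrict (Ioo 0 T)).prod volume) := by
        refine lintegral_congr fun ξ => ?_
        have hmξ : AEMeasurable (fun z : ℝ × UnitAddTorus d => ‖f z.1 (z.2 + FunctionSpaces.Torus.proj ξ)‖ₑ ^ q)
            ((volume.restrict (Ioo 0 T)).prod volume) :=
          (aestronglyMeasurable_uncurry_comp_add hf _).enorm.pow_const q
        rw [lintegral_const_mul'' _ hmξ, lintegral_translate_enorm_rpow]
    _ = ∫⁻ z, ‖uncurry f z‖ₑ ^ q ∂((volume.restrict (Ioo 0 T)).prod volume) := by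
        rw [lintegral_mul_const _ hwm, hw1, one_mul]

/-- **Uniform `L^q` convergence of kernel mollifications**: for `f` jointly measurable with
`∫∫ ‖f‖^q < ∞` (`1 ≤ q`), and `η > 0`, there is `ε₀ > 0` such that `∫∫ ‖f^ε − f‖^q ≤ η` for every
unit-ball mollifier `φ` and every `ε ∈ (0, ε₀)` — uniformly in `φ` (continuity of translation in
`L^q` and the Jensen–Tonelli bound; Eyink 2003, §2: "`‖u(·+ℓ) − u‖_{L³} → 0` as `ℓ → 0` … hence
`‖u_L^ε − ⅓u‖_{L³} → 0`"). [folklore] -/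
theorem exists_forall_lintegral_kernelAverage_sub_rpow_le [DecidableEq d] [CompleteSpace F]
    {f : ℝ → UnitAddTorus d → F}
    (hf : AEStronglyMeasurable (uncurry f) ((volume.restrict (Ioo 0 T)).prod volume))
    {q : ℝ} (hq : 1 ≤ q)
    (hfq : ∫⁻ z, ‖uncurry f z‖ₑ ^ q ∂((volume.restrict (Ioo 0 T)).prod volume) < ∞)
    {η : ℝ≥0∞} (hη : 0 < η) :
    ∃ ε₀ > 0, ∀ φ, IsUnitBallMollifier φ → ∀ ε ∈ Ioo 0 ε₀,
      ∫⁻ z, ‖(∫ ξ, FluidPDE.mollifierScale ε φ ξ • f z.1 (z.2 + FunctionSpaces.Torus.proj ξ)) - f z.1 z.2‖ₑ ^ q ∂((volume.restrict (Ioo 0 T)).prod volume) ≤ η := by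
  have hq0 : 0 < q := one_pos.trans_le hq
  -- integrable slices
  have hqE : (1 : ℝ≥0∞) ≤ ENNReal.ofReal q := by
    rw [← ENNReal.ofReal_one]; exact ENNReal.ofReal_le_ofReal hq
  have hU : MemLp (uncurry f) (ENNReal.ofReal q) ((volume.restrict (Ioo 0 T)).prod volume) := by
    refine ⟨hf, ?_⟩
    rw [eLpNorm_eq_lintegral_rpow_enorm_toReal (by simpa using hq0) ENNReal.ofReal_ne_top,
      ENNReal.toReal_ofReal hq0.le]
    exact ENNReal.rpow_lt_top_of_nonneg (by positivity) hfq.ne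
  have hfi : ∀ᵐ t ∂(volume.restrict (Ioo 0 T)), Integrable (f t) volume :=
    (hU.integrable hqE).prod_right_ae
  -- continuity of translation (`Torus.tendsto_lintegral_translate_sub`, `BallAverageLimits`),
  -- in product form, through the covering map
  have hfq' : ∫⁻ t in Ioo 0 T, ∫⁻ x, ‖f t x‖ₑ ^ q < ∞ := by
    rwa [lintegral_Ioo_lintegral_eq_lintegral_prod (g := fun t x => ‖f t x‖ₑ ^ q) (hf.enorm.pow_const q)]
  have htr : Tendsto (fun a : UnitAddTorus d => ∫⁻ z, ‖f z.1 (z.2 + a) - f z.1 z.2‖ₑ ^ q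
      ∂((volume.restrict (Ioo 0 T)).prod volume)) (𝓝 0) (𝓝 0) := by
    refine (tendsto_lintegral_translate_sub hq hf hfq').congr fun a => ?_
    exact lintegral_Ioo_lintegral_eq_lintegral_prod (g := fun t x => ‖f t (x + a) - f t x‖ₑ ^ q)
      (((aestronglyMeasurable_uncurry_comp_add hf a).sub hf).enorm.pow_const q)
  have hproj : Tendsto (FunctionSpaces.Torus.proj : EuclideanSpace ℝ d → UnitAddTorus d) (𝓝 0) (𝓝 0) := by
    have := FunctionSpaces.Torus.continuous_proj.tendsto (0 : EuclideanSpace ℝ d)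
    rwa [FunctionSpaces.Torus.proj_zero] at this
  have h := htr.comp hproj
  obtain ⟨δ, hδ, hδb⟩ : ∃ δ > 0, ∀ ξ : EuclideanSpace ℝ d, ‖ξ‖ < δ →
      ∫⁻ z, ‖f z.1 (z.2 + FunctionSpaces.Torus.proj ξ) - f z.1 z.2‖ₑ ^ q
        ∂((volume.restrict (Ioo 0 T)).prod volume) ≤ η := by
    obtain ⟨δ, hδ, hb⟩ := Metric.eventually_nhds_iff.1 (h.eventually (gt_mem_nhds hη))
    exact ⟨δ, hδ, fun ξ hξ => (hb (by simpa [dist_zero_right] using hξ)).le⟩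
  refine ⟨δ, hδ, fun φ hφ ε hε => ?_⟩
  refine (lintegral_enorm_kernelAverage_sub_rpow_le hφ hε.1 hf hfi hq).trans ?_
  have hwm := measurable_ofReal_mollifierScale hφ.1 hε.1
  calc ∫⁻ ξ, ENNReal.ofReal (FluidPDE.mollifierScale ε φ ξ) *
        ∫⁻ z, ‖f z.1 (z.2 + FunctionSpaces.Torus.proj ξ) - f z.1 z.2‖ₑ ^ q
          ∂((volume.restrict (Ioo 0 T)).prod volume)
      ≤ ∫⁻ ξ, ENNReal.ofReal (FluidPDE.mollifierScale ε φ ξ) * η := by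
        refine lintegral_mono fun ξ => ?_
        by_cases hξ : ‖ξ‖ ≤ ε
        · exact mul_le_mul_right (hδb ξ (hξ.trans_lt hε.2)) _
        · rw [hφ.mollifierScale_eq_zero hε.1 (not_le.1 hξ), ENNReal.ofReal_zero, zero_mul, zero_mul]
    _ = η := by rw [lintegral_mul_const _ hwm, lintegral_ofReal_mollifierScale hφ.1 hε.1, one_mul]

end KernelLq

/-! ## Hölder inequalities in the two shapes used below -/

section HolderShapes

variable {α : Type*} [MeasurableSpace α] (μ : Measure α)

/-- Cauchy–Schwarz for lower integrals: `∫⁻ f g ≤ (∫⁻ f²)^{1/2} (∫⁻ g²)^{1/2}`. [folklore] -/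
theorem lintegral_mul_le_sqrt_mul_sqrt {f g : α → ℝ≥0∞} (hf : AEMeasurable f μ) (hg : AEMeasurable g μ) :
    ∫⁻ a, f a * g a ∂μ ≤ (∫⁻ a, f a ^ (2 : ℝ) ∂μ) ^ (1 / 2 : ℝ) * (∫⁻ a, g a ^ (2 : ℝ) ∂μ) ^ (1 / 2 : ℝ) := by
  have hpq : Real.HolderConjugate 2 2 := Real.holderConjugate_iff.2 ⟨by norm_num, by norm_num⟩
  have h := ENNReal.lintegral_mul_le_Lp_mul_Lq μ hpq hf hg
  simpa only [Pi.mul_apply] using h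

end HolderShapes

/-! ## The pointwise algebra of the scale-`ε` integrand -/

section Pointwise

variable {E' : Type*} [NormedAddCommGroup E'] [InnerProductSpace ℝ E']

/-- **The scale-`ε` integrand minus its limit**, pointwise: with `θ = ∂ₜψ`, `G = ∇ψ`,
`[½⟪u,u^ε⟫θ + ½⟪u,u^ε⟫⟪u,G⟫ + ½(p⟪u^ε,G⟫ + p^ε⟪u,G⟫) + ¼(⟪w^ε,G⟫ − s^ε⟪u,G⟫)]
 − [½|u|²θ + (½|u|² + p)⟪u,G⟫]`
is bounded by
`½C₁|u||u^ε−u| + ½C₂|u|²|u^ε−u| + ½C₂(|p||u^ε−u| + |p^ε−p||u|) + ¼C₂(|w^ε − |u|²u| + |s^ε − |u|²||u|)`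
when `|θ| ≤ C₁`, `|G| ≤ C₂` (here `w = |u|²u`, `s = |u|²`, so that `⟪w,G⟫ = s⟪u,G⟫`). [folklore] -/
theorem abs_scaleIntegrand_sub_le (u uε wε G : E') (p pε sε θ : ℝ) {C₁ C₂ : ℝ}
    (hθ : |θ| ≤ C₁) (hG : ‖G‖ ≤ C₂) :
    |(2⁻¹ * ⟪u, uε⟫ * θ + 2⁻¹ * ⟪u, uε⟫ * ⟪u, G⟫ + 2⁻¹ * (p * ⟪uε, G⟫ + pε * ⟪u, G⟫) +
        4⁻¹ * (⟪wε, G⟫ - sε * ⟪u, G⟫)) -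
      (2⁻¹ * ‖u‖ ^ 2 * θ + (2⁻¹ * ‖u‖ ^ 2 + p) * ⟪u, G⟫)| ≤
      2⁻¹ * C₁ * (‖u‖ * ‖uε - u‖) + 2⁻¹ * C₂ * (‖u‖ ^ 2 * ‖uε - u‖) +
        2⁻¹ * C₂ * (|p| * ‖uε - u‖ + |pε - p| * ‖u‖) +
        4⁻¹ * C₂ * (‖wε - ‖u‖ ^ 2 • u‖ + |sε - ‖u‖ ^ 2| * ‖u‖) := by
  have hC₁ : 0 ≤ C₁ := (abs_nonneg θ).trans hθ
  have hC₂ : 0 ≤ C₂ := (norm_nonneg G).trans hG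
  -- rewrite the difference
  have key : (2⁻¹ * ⟪u, uε⟫ * θ + 2⁻¹ * ⟪u, uε⟫ * ⟪u, G⟫ + 2⁻¹ * (p * ⟪uε, G⟫ + pε * ⟪u, G⟫) +
        4⁻¹ * (⟪wε, G⟫ - sε * ⟪u, G⟫)) -
      (2⁻¹ * ‖u‖ ^ 2 * θ + (2⁻¹ * ‖u‖ ^ 2 + p) * ⟪u, G⟫) =
      2⁻¹ * ⟪u, uε - u⟫ * θ + 2⁻¹ * ⟪u, uε - u⟫ * ⟪u, G⟫ +
        2⁻¹ * (p * ⟪uε - u, G⟫ + (pε - p) * ⟪u, G⟫) +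
        4⁻¹ * (⟪wε - ‖u‖ ^ 2 • u, G⟫ - (sε - ‖u‖ ^ 2) * ⟪u, G⟫) := by
    rw [inner_sub_right, inner_sub_left, inner_sub_left, real_inner_smul_left, real_inner_self_eq_norm_sq]
    ring
  rw [key]
  -- the elementary bounds
  have hg : |⟪u, G⟫| ≤ ‖u‖ * C₂ := (abs_real_inner_le_norm u G).trans (by gcongr)
  have h1 : |2⁻¹ * ⟪u, uε - u⟫ * θ| ≤ 2⁻¹ * C₁ * (‖u‖ * ‖uε - u‖) := by
    rw [abs_mul, abs_mul, abs_of_pos (by norm_num : (0 : ℝ) < 2⁻¹)]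
    calc 2⁻¹ * |⟪u, uε - u⟫| * |θ| ≤ 2⁻¹ * (‖u‖ * ‖uε - u‖) * C₁ := by
          gcongr; exact abs_real_inner_le_norm _ _
      _ = 2⁻¹ * C₁ * (‖u‖ * ‖uε - u‖) := by ring
  have h2 : |2⁻¹ * ⟪u, uε - u⟫ * ⟪u, G⟫| ≤ 2⁻¹ * C₂ * (‖u‖ ^ 2 * ‖uε - u‖) := by
    rw [abs_mul, abs_mul, abs_of_pos (by norm_num : (0 : ℝ) < 2⁻¹)]
    calc 2⁻¹ * |⟪u, uε - u⟫| * |⟪u, G⟫| ≤ 2⁻¹ * (‖u‖ * ‖uε - u‖) * (‖u‖ * C₂) := by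
          gcongr; exact abs_real_inner_le_norm _ _
      _ = 2⁻¹ * C₂ * (‖u‖ ^ 2 * ‖uε - u‖) := by ring
  have h3 : |2⁻¹ * (p * ⟪uε - u, G⟫ + (pε - p) * ⟪u, G⟫)| ≤
      2⁻¹ * C₂ * (|p| * ‖uε - u‖ + |pε - p| * ‖u‖) := by
    rw [abs_mul, abs_of_pos (by norm_num : (0 : ℝ) < 2⁻¹)]
    have ha : |p * ⟪uε - u, G⟫| ≤ |p| * (‖uε - u‖ * C₂) := by
      rw [abs_mul]; gcongr; exact (abs_real_inner_le_norm _ _).trans (by gcongr)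
    have hb : |(pε - p) * ⟪u, G⟫| ≤ |pε - p| * (‖u‖ * C₂) := by
      rw [abs_mul]; gcongr
    calc 2⁻¹ * |p * ⟪uε - u, G⟫ + (pε - p) * ⟪u, G⟫|
        ≤ 2⁻¹ * (|p| * (‖uε - u‖ * C₂) + |pε - p| * (‖u‖ * C₂)) := by
          gcongr; exact (abs_add_le _ _).trans (add_le_add ha hb)
      _ = 2⁻¹ * C₂ * (|p| * ‖uε - u‖ + |pε - p| * ‖u‖) := by ring
  have h4 : |4⁻¹ * (⟪wε - ‖u‖ ^ 2 • u, G⟫ - (sε - ‖u‖ ^ 2) * ⟪u, G⟫)| ≤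
      4⁻¹ * C₂ * (‖wε - ‖u‖ ^ 2 • u‖ + |sε - ‖u‖ ^ 2| * ‖u‖) := by
    rw [abs_mul, abs_of_pos (by norm_num : (0 : ℝ) < 4⁻¹)]
    have ha : |⟪wε - ‖u‖ ^ 2 • u, G⟫| ≤ ‖wε - ‖u‖ ^ 2 • u‖ * C₂ :=
      (abs_real_inner_le_norm _ _).trans (by gcongr)
    have hb : |(sε - ‖u‖ ^ 2) * ⟪u, G⟫| ≤ |sε - ‖u‖ ^ 2| * (‖u‖ * C₂) := by
      rw [abs_mul]; gcongr
    calc 4⁻¹ * |⟪wε - ‖u‖ ^ 2 • u, G⟫ - (sε - ‖u‖ ^ 2) * ⟪u, G⟫|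
        ≤ 4⁻¹ * (‖wε - ‖u‖ ^ 2 • u‖ * C₂ + |sε - ‖u‖ ^ 2| * (‖u‖ * C₂)) := by
          gcongr; exact (abs_sub _ _).trans (add_le_add ha hb)
      _ = 4⁻¹ * C₂ * (‖wε - ‖u‖ ^ 2 • u‖ + |sε - ‖u‖ ^ 2| * ‖u‖) := by ring
  calc _ ≤ |2⁻¹ * ⟪u, uε - u⟫ * θ + 2⁻¹ * ⟪u, uε - u⟫ * ⟪u, G⟫ +
          2⁻¹ * (p * ⟪uε - u, G⟫ + (pε - p) * ⟪u, G⟫)| +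
        |4⁻¹ * (⟪wε - ‖u‖ ^ 2 • u, G⟫ - (sε - ‖u‖ ^ 2) * ⟪u, G⟫)| := abs_add_le _ _
    _ ≤ (|2⁻¹ * ⟪u, uε - u⟫ * θ + 2⁻¹ * ⟪u, uε - u⟫ * ⟪u, G⟫| +
          |2⁻¹ * (p * ⟪uε - u, G⟫ + (pε - p) * ⟪u, G⟫)|) +
        |4⁻¹ * (⟪wε - ‖u‖ ^ 2 • u, G⟫ - (sε - ‖u‖ ^ 2) * ⟪u, G⟫)| := by
          gcongr; exact abs_add_le _ _
    _ ≤ ((|2⁻¹ * ⟪u, uε - u⟫ * θ| + |2⁻¹ * ⟪u, uε - u⟫ * ⟪u, G⟫|) +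
          |2⁻¹ * (p * ⟪uε - u, G⟫ + (pε - p) * ⟪u, G⟫)|) +
        |4⁻¹ * (⟪wε - ‖u‖ ^ 2 • u, G⟫ - (sε - ‖u‖ ^ 2) * ⟪u, G⟫)| := by
          gcongr; exact abs_add_le _ _
    _ ≤ _ := by linarith [h1, h2, h3, h4]

end Pointwise

/-! ## The divergence of the symmetric test field -/

section Divergence

variable [DecidableEq d]

/-- **Divergence of a mollified field**: for `u ∈ L¹(T^d; ℝ^d)` and a smooth kernel `K`,
`div (u ⋆ K)(x) = −∫ ⟪u(y), ∇_y K(x − y)⟫ dy` (`∂ᵢ(uᵢ ⋆ K) = uᵢ ⋆ ∂ᵢK`; the general-kernel form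
of the tree's `Torus.divergence_vecMollify`). [folklore] -/
theorem divergence_vecConv {u : UnitAddTorus d → EuclideanSpace ℝ d} (hu : Integrable u volume)
    {K : UnitAddTorus d → ℝ} (hK : FunctionSpaces.Torus.IsSmooth K) (x : UnitAddTorus d) :
    FunctionSpaces.Torus.divergence (vecConv u K) x =
      -∫ y, ⟪u y, FunctionSpaces.Torus.gradient (fun y => K (x - y)) y⟫ := by
  have hK1 : FunctionSpaces.Torus.IsContDiff 1 K := hK.isContDiff (by simp)
  have hcomp : ∀ i, (fun y => vecConv u K y i) = (fun y => u y i) ⋆ K := fun i => by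
    funext y; simp [vecConv_apply]
  simp only [FunctionSpaces.Torus.divergence, hcomp,
    FunctionSpaces.Torus.partialDeriv_convolution (hu.eval_piLp _) hK, convolution_lsmul]
  rw [← integral_finsetSum _ fun i _ =>
      FunctionSpaces.Torus.integrable_smul_comp_sub (hu.eval_piLp i) (hK.partialDeriv i).continuous x,
    ← integral_neg]
  refine integral_congr_ae (Eventually.of_forall fun y => ?_)
  dsimp only
  rw [FunctionSpaces.Torus.gradient_comp_sub_left, inner_neg_right, neg_neg,
    FunctionSpaces.Torus.gradient_eq_sum_partialDeriv hK1, inner_sum]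
  refine Finset.sum_congr rfl fun i _ => ?_
  rw [real_inner_smul_right, EuclideanSpace.inner_single_right]
  simp [smul_eq_mul, mul_comm]

/-- **Mollifications of weakly divergence-free fields are divergence free**, for any smooth
kernel (test the weak condition with `y ↦ K(x − y)`). [folklore] -/
theorem divergence_vecConv_eq_zero {u : UnitAddTorus d → EuclideanSpace ℝ d} (hu : Integrable u volume)
    (hdiv : FunctionSpaces.Torus.IsWeaklyDivFree u) {K : UnitAddTorus d → ℝ}
    (hK : FunctionSpaces.Torus.IsSmooth K) (x : UnitAddTorus d) :
    FunctionSpaces.Torus.divergence (vecConv u K) x = 0 := by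
  rw [divergence_vecConv hu hK, hdiv _ (hK.comp_sub_left x), neg_zero]

/-- **Divergence of the mollification of a cut-off field**: for `u ∈ L¹` weakly divergence free,
a smooth kernel `K` and a smooth scalar `χ`, `div((χu) ⋆ K) = ⟪u, ∇χ⟫ ⋆ K` (test the weak
condition with `y ↦ χ(y) K(x − y)`). [folklore] -/
theorem divergence_vecConv_smul {u : UnitAddTorus d → EuclideanSpace ℝ d} (hu : Integrable u volume)
    (hdiv : FunctionSpaces.Torus.IsWeaklyDivFree u) {K : UnitAddTorus d → ℝ}
    (hK : FunctionSpaces.Torus.IsSmooth K) {χ : UnitAddTorus d → ℝ} (hχ : FunctionSpaces.Torus.IsSmooth χ)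
    (x : UnitAddTorus d) :
    FunctionSpaces.Torus.divergence (vecConv (fun y => χ y • u y) K) x =
      ((fun y => ⟪u y, FunctionSpaces.Torus.gradient χ y⟫) ⋆ K) x := by
  obtain ⟨Cχ, hCχ⟩ := FunctionSpaces.Torus.exists_forall_norm_le_of_continuous hχ.continuous
  have hχu : Integrable (fun y => χ y • u y) volume :=
    hu.bdd_smul Cχ hχ.continuous.aestronglyMeasurable (ae_of_all _ hCχ)
  rw [divergence_vecConv hχu hK]
  -- the weak divergence condition tested with `θ(y) = χ(y) K(x - y)`
  have hθ : FunctionSpaces.Torus.IsSmooth fun y => χ y * K (x - y) := hχ.mul (hK.comp_sub_left x)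
  have hχ1 : FunctionSpaces.Torus.IsContDiff 1 χ := hχ.isContDiff (by simp)
  have hKx1 : FunctionSpaces.Torus.IsContDiff 1 fun y => K (x - y) := (hK.comp_sub_left x).isContDiff (by simp)
  have hgrad : ∀ y, FunctionSpaces.Torus.gradient (fun y => χ y * K (x - y)) y =
      χ y • FunctionSpaces.Torus.gradient (fun y => K (x - y)) y +
        K (x - y) • FunctionSpaces.Torus.gradient χ y := fun y => by
    rw [FunctionSpaces.Torus.gradient_eq_sum_partialDeriv (hθ.isContDiff (by simp)),
      FunctionSpaces.Torus.gradient_eq_sum_partialDeriv hKx1,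
      FunctionSpaces.Torus.gradient_eq_sum_partialDeriv hχ1, Finset.smul_sum, Finset.smul_sum,
      ← Finset.sum_add_distrib]
    refine Finset.sum_congr rfl fun i _ => ?_
    rw [FunctionSpaces.Torus.partialDeriv_mul hχ1 hKx1, add_smul, smul_smul, smul_smul, mul_comm (K (x - y))]
  have h0 := hdiv _ hθ
  simp_rw [hgrad, inner_add_right, real_inner_smul_right] at h0
  -- integrability of the two pieces
  have hI1 : Integrable (fun y => χ y * ⟪u y, FunctionSpaces.Torus.gradient (fun y => K (x - y)) y⟫) volume := by
    have hg : Continuous fun y => FunctionSpaces.Torus.gradient (fun y => K (x - y)) y := by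
      have : (fun y => FunctionSpaces.Torus.gradient (fun y => K (x - y)) y) =
          fun y => -FunctionSpaces.Torus.gradient K (x - y) := funext fun y =>
        FunctionSpaces.Torus.gradient_comp_sub_left K x y
      rw [this]
      exact (hK.gradient.continuous.comp (continuous_const.sub continuous_id)).neg
    obtain ⟨Cg, hCg⟩ := FunctionSpaces.Torus.exists_forall_norm_le_of_continuous hg
    have h1 : Integrable (fun y => ⟪u y, FunctionSpaces.Torus.gradient (fun y => K (x - y)) y⟫) volume :=
      (hu.norm.mul_const Cg).mono' (hu.aestronglyMeasurable.inner hg.aestronglyMeasurable)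
        (ae_of_all _ fun y => (norm_inner_le_norm _ _).trans (by gcongr; exact hCg y))
    exact (h1.norm.const_mul Cχ).mono' (hχ.continuous.aestronglyMeasurable.mul h1.aestronglyMeasurable)
      (ae_of_all _ fun y => by rw [norm_mul]; gcongr; exact hCχ y)
  have hI2 : Integrable (fun y => K (x - y) * ⟪u y, FunctionSpaces.Torus.gradient χ y⟫) volume := by
    obtain ⟨Cg, hCg⟩ := FunctionSpaces.Torus.exists_forall_norm_le_of_continuous hχ.gradient.continuous
    obtain ⟨CK, hCK⟩ := FunctionSpaces.Torus.exists_forall_norm_le_of_continuous hK.continuous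
    have h1 : Integrable (fun y => ⟪u y, FunctionSpaces.Torus.gradient χ y⟫) volume :=
      (hu.norm.mul_const Cg).mono' (hu.aestronglyMeasurable.inner hχ.gradient.continuous.aestronglyMeasurable)
        (ae_of_all _ fun y => (norm_inner_le_norm _ _).trans (by gcongr; exact hCg y))
    exact (h1.norm.const_mul CK).mono'
      ((hK.continuous.comp (continuous_const.sub continuous_id)).aestronglyMeasurable.mul h1.aestronglyMeasurable)
      (ae_of_all _ fun y => by rw [norm_mul]; gcongr; exact hCK _)
  rw [integral_add hI1 hI2] at h0
  -- conclude
  have hpieces : (∫ y, ⟪χ y • u y, FunctionSpaces.Torus.gradient (fun y => K (x - y)) y⟫) =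
      ∫ y, χ y * ⟪u y, FunctionSpaces.Torus.gradient (fun y => K (x - y)) y⟫ :=
    integral_congr_ae (ae_of_all _ fun y => real_inner_smul_left _ _ _)
  rw [hpieces, show (∫ y, χ y * ⟪u y, FunctionSpaces.Torus.gradient (fun y => K (x - y)) y⟫) =
      -∫ y, K (x - y) * ⟪u y, FunctionSpaces.Torus.gradient χ y⟫ by linarith, neg_neg, convolution_lsmul]
  refine integral_congr_ae (ae_of_all _ fun y => ?_)
  simp [smul_eq_mul, mul_comm]

end Divergence

/-! ## Bridge: torus convolution with `K_ε` as a Euclidean kernel average -/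

section Bridge

variable [DecidableEq d] {F : Type*} [NormedAddCommGroup F] [NormedSpace ℝ F]

/-- Integrability of the Euclidean mollification integrand for a general mollifier:
`ξ ↦ φ^ε(ξ) f(x + π ξ)` is integrable on `ℝ^d` for `f ∈ L¹(T^d)` and `ε > 0`. [folklore] -/
theorem integrable_mollifierScale_smul_translate' {φ : EuclideanSpace ℝ d → ℝ}
    (hφ : FluidPDE.IsMollifier φ) {ε : ℝ} (hε : 0 < ε) {f : UnitAddTorus d → F}
    (hf : Integrable f volume) (x : UnitAddTorus d) :
    Integrable (fun ξ => FluidPDE.mollifierScale ε φ ξ • f (x + FunctionSpaces.Torus.proj ξ)) volume := by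
  obtain ⟨hs, R, hR⟩ := exists_tsupport_mollifierScale_subset hφ hε
  have hfx : Integrable (fun y => f (x + y)) volume := hf.comp_add_left x
  have hlift : IntegrableOn (FunctionSpaces.Torus.lift fun y => f (x + y)) (closedBall 0 R) volume :=
    FunctionSpaces.Torus.integrableOn_lift_of_subset_closedBall hfx Subset.rfl
  have hK : IntegrableOn (fun ξ => FluidPDE.mollifierScale ε φ ξ • f (x + FunctionSpaces.Torus.proj ξ))
      (closedBall 0 R) volume :=
    hlift.continuousOn_smul hs.continuous.continuousOn (isCompact_closedBall _ _)
  refine hK.integrable_of_forall_notMem_eq_zero fun ξ hξ => ?_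
  rw [image_eq_zero_of_notMem_tsupport (fun h => hξ (hR h)), zero_smul]

/-- **The torus convolution with `K_ε` is the Euclidean kernel average**: for `f ∈ L¹(T^d)`,
a mollifier `φ` and `ε > 0`,
`(f ⋆ K_ε)(x) = ∫_{ℝ^d} φ^ε(ξ) f(x + π ξ) dξ` (translation invariance, evenness of `K_ε` and the
unfolding `Torus.integral_eq_integral_perSum_repr`; the bridge announced in
`four_mul_duchonRobertApprox_eq_kernelFlux`). [folklore] -/
theorem convolution_mollifierKernel_apply {φ : EuclideanSpace ℝ d → ℝ} (hφ : FluidPDE.IsMollifier φ)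
    {ε : ℝ} (hε : 0 < ε) {f : UnitAddTorus d → ℝ} (hf : Integrable f volume) (x : UnitAddTorus d) :
    (f ⋆ mollifierKernel φ ε) x = ∫ ξ, FluidPDE.mollifierScale ε φ ξ * f (x + FunctionSpaces.Torus.proj ξ) := by
  obtain ⟨hs, R, hR⟩ := exists_tsupport_mollifierScale_subset hφ hε
  -- `(f ⋆ K)(x) = ∫ f(x + z) K(z) dz`
  have h1 : (f ⋆ mollifierKernel φ ε) x = ∫ z, mollifierKernel φ ε z * f (x + z) := by
    rw [convolution_lsmul, ← integral_add_left_eq_self _ x]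
    refine integral_congr_ae (ae_of_all _ fun z => ?_)
    simp only [smul_eq_mul]
    rw [show x - (x + z) = -z by abel, mollifierKernel_neg hφ, mul_comm]
  rw [h1]
  -- unfold the periodisation
  set G : EuclideanSpace ℝ d → ℝ := fun ξ => FluidPDE.mollifierScale ε φ ξ * f (x + FunctionSpaces.Torus.proj ξ)
    with hG
  have hGi : Integrable G volume := integrable_mollifierScale_smul_translate' hφ hε hf x
  have hGs : support G ⊆ closedBall 0 R := by
    refine fun ξ hξ => hR (subset_tsupport _ fun h0 => hξ ?_)
    simp only [hG, h0, zero_mul]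
  rw [show (∫ ξ, FluidPDE.mollifierScale ε φ ξ * f (x + FunctionSpaces.Torus.proj ξ)) = ∫ ξ, G ξ from rfl,
    FunctionSpaces.Torus.integral_eq_integral_perSum_repr hGi hGs]
  refine integral_congr_ae (ae_of_all _ fun z => ?_)
  have hz : ‖FunctionSpaces.Torus.repr z‖ ≤ Fintype.card d :=
    FunctionSpaces.Torus.norm_le_card_of_mem_unitCube (FunctionSpaces.Torus.repr_mem_unitCube z)
  obtain ⟨n, hn⟩ := exists_nat_ge (R + Fintype.card d)
  dsimp only
  rw [mollifierKernel_apply, FunctionSpaces.Torus.perSum_eq_sum hGs hz hn,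
    FunctionSpaces.Torus.perSum_eq_sum ((subset_tsupport _).trans hR) hz hn, Finset.sum_mul]
  refine Finset.sum_congr rfl fun k _ => ?_
  simp only [hG, FunctionSpaces.Torus.proj_add_latticeVec, FunctionSpaces.Torus.proj_repr]

/-- Vector form of the bridge: `(v ⋆ K_ε)(x) = ∫_{ℝ^d} φ^ε(ξ) v(x + π ξ) dξ` componentwise
(`Torus.vecConv`). [folklore] -/
theorem vecConv_mollifierKernel_apply {φ : EuclideanSpace ℝ d → ℝ} (hφ : FluidPDE.IsMollifier φ)
    {ε : ℝ} (hε : 0 < ε) {v : UnitAddTorus d → EuclideanSpace ℝ d} (hv : Integrable v volume)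
    (x : UnitAddTorus d) :
    vecConv v (mollifierKernel φ ε) x = ∫ ξ, FluidPDE.mollifierScale ε φ ξ • v (x + FunctionSpaces.Torus.proj ξ) := by
  have hint := integrable_mollifierScale_smul_translate' hφ hε hv x
  ext i
  rw [vecConv_apply, convolution_mollifierKernel_apply hφ hε (hv.eval_piLp i)]
  have h := ((EuclideanSpace.proj i : EuclideanSpace ℝ d →L[ℝ] ℝ).integral_comp_comm hint).symm
  have h' : (∫ ξ, FluidPDE.mollifierScale ε φ ξ • v (x + FunctionSpaces.Torus.proj ξ)) i =
      ∫ ξ, (FluidPDE.mollifierScale ε φ ξ • v (x + FunctionSpaces.Torus.proj ξ)) i := h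
  rw [h']
  refine integral_congr_ae (ae_of_all _ fun ξ => ?_)
  simp [smul_eq_mul]

end Bridge

/-! ## Mollified space–time fields through `K_ε`: measurability and `L^q` bounds -/

section MollifiedFields

variable [DecidableEq d] {T : ℝ} {φ : EuclideanSpace ℝ d → ℝ} {ε : ℝ}

/-- **A.e. bridge, vector fields**: for `v` with integrable slices, `(v(t) ⋆ K_ε)(x)` is the
Euclidean kernel average at a.e. `(t,x) ∈ (0,T) × T^d`. [folklore] -/
theorem ae_vecConv_mollifierKernel_eq (hφ : FluidPDE.IsMollifier φ) (hε : 0 < ε)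
    {v : ℝ → UnitAddTorus d → EuclideanSpace ℝ d}
    (hvi : ∀ᵐ t ∂(volume.restrict (Ioo 0 T)), Integrable (v t) volume) :
    ∀ᵐ z ∂((volume.restrict (Ioo 0 T)).prod (volume : Measure (UnitAddTorus d))),
      vecConv (v z.1) (mollifierKernel φ ε) z.2 =
        ∫ ξ, FluidPDE.mollifierScale ε φ ξ • v z.1 (z.2 + FunctionSpaces.Torus.proj ξ) := by
  filter_upwards [(quasiMeasurePreserving_fst (μ := volume.restrict (Ioo 0 T))
    (ν := (volume : Measure (UnitAddTorus d)))).ae hvi] with z hz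
  exact vecConv_mollifierKernel_apply hφ hε hz z.2

/-- **A.e. bridge, scalar fields.** [folklore] -/
theorem ae_convolution_mollifierKernel_eq (hφ : FluidPDE.IsMollifier φ) (hε : 0 < ε)
    {f : ℝ → UnitAddTorus d → ℝ}
    (hfi : ∀ᵐ t ∂(volume.restrict (Ioo 0 T)), Integrable (f t) volume) :
    ∀ᵐ z ∂((volume.restrict (Ioo 0 T)).prod (volume : Measure (UnitAddTorus d))),
      (f z.1 ⋆ mollifierKernel φ ε) z.2 =
        ∫ ξ, FluidPDE.mollifierScale ε φ ξ • f z.1 (z.2 + FunctionSpaces.Torus.proj ξ) := by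
  filter_upwards [(quasiMeasurePreserving_fst (μ := volume.restrict (Ioo 0 T))
    (ν := (volume : Measure (UnitAddTorus d)))).ae hfi] with z hz
  rw [convolution_mollifierKernel_apply hφ hε hz z.2]
  rfl

/-- **Mollified vector fields: measurability and `L^q` bounds** on `(0,T) × T^d`. For `v` jointly
measurable with integrable slices, a unit-ball mollifier `φ`, `ε > 0` and `q ≥ 1`:
`(t,x) ↦ (v(t) ⋆ K_ε)(x)` is a.e.-strongly measurable, `∫∫ ‖v ⋆ K_ε‖^q ≤ ∫∫ ‖v‖^q`, and
`∫∫ ‖v ⋆ K_ε − v‖^q` equals the kernel-average deviation controlled by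
`exists_forall_lintegral_kernelAverage_sub_rpow_le`. [folklore] -/
theorem vecConv_mollifierKernel_facts (hφ : IsUnitBallMollifier φ) (hε : 0 < ε)
    {v : ℝ → UnitAddTorus d → EuclideanSpace ℝ d}
    (hv : AEStronglyMeasurable (uncurry v) ((volume.restrict (Ioo 0 T)).prod volume))
    (hvi : ∀ᵐ t ∂(volume.restrict (Ioo 0 T)), Integrable (v t) volume) {q : ℝ} (hq : 1 ≤ q) :
    AEStronglyMeasurable (fun z : ℝ × UnitAddTorus d => vecConv (v z.1) (mollifierKernel φ ε) z.2)
        ((volume.restrict (Ioo 0 T)).prod volume) ∧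
      (∫⁻ z, ‖vecConv (v z.1) (mollifierKernel φ ε) z.2‖ₑ ^ q ∂((volume.restrict (Ioo 0 T)).prod volume) ≤
        ∫⁻ z, ‖uncurry v z‖ₑ ^ q ∂((volume.restrict (Ioo 0 T)).prod volume)) ∧
      (∫⁻ z, ‖vecConv (v z.1) (mollifierKernel φ ε) z.2 - v z.1 z.2‖ₑ ^ q
          ∂((volume.restrict (Ioo 0 T)).prod volume) =
        ∫⁻ z, ‖(∫ ξ, FluidPDE.mollifierScale ε φ ξ • v z.1 (z.2 + FunctionSpaces.Torus.proj ξ)) - v z.1 z.2‖ₑ ^ q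
          ∂((volume.restrict (Ioo 0 T)).prod volume)) := by
  have hbr := ae_vecConv_mollifierKernel_eq (T := T) hφ.1 hε hvi
  have hm := aestronglyMeasurable_kernelAverage (T := T) (hφ.1.mollifierScale hε).1.continuous hv
  refine ⟨hm.congr (hbr.mono fun z hz => hz.symm), ?_, ?_⟩
  · calc ∫⁻ z, ‖vecConv (v z.1) (mollifierKernel φ ε) z.2‖ₑ ^ q ∂((volume.restrict (Ioo 0 T)).prod volume)
        = ∫⁻ z, ‖(∫ ξ, FluidPDE.mollifierScale ε φ ξ • v z.1 (z.2 + FunctionSpaces.Torus.proj ξ))‖ₑ ^ q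
            ∂((volume.restrict (Ioo 0 T)).prod volume) :=
          lintegral_congr_ae (hbr.mono fun z hz => by simp only [hz])
      _ ≤ _ := lintegral_enorm_kernelAverage_rpow_le hφ hε hv hq
  · exact lintegral_congr_ae (hbr.mono fun z hz => by simp only [hz])

/-- **Mollified scalar fields: measurability and `L^q` bounds** (as `vecConv_mollifierKernel_facts`). [folklore] -/
theorem convolution_mollifierKernel_facts (hφ : IsUnitBallMollifier φ) (hε : 0 < ε)
    {f : ℝ → UnitAddTorus d → ℝ}
    (hf : AEStronglyMeasurable (uncurry f) ((volume.restrict (Ioo 0 T)).prod volume))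
    (hfi : ∀ᵐ t ∂(volume.restrict (Ioo 0 T)), Integrable (f t) volume) {q : ℝ} (hq : 1 ≤ q) :
    AEStronglyMeasurable (fun z : ℝ × UnitAddTorus d => (f z.1 ⋆ mollifierKernel φ ε) z.2)
        ((volume.restrict (Ioo 0 T)).prod volume) ∧
      (∫⁻ z, ‖(f z.1 ⋆ mollifierKernel φ ε) z.2‖ₑ ^ q ∂((volume.restrict (Ioo 0 T)).prod volume) ≤
        ∫⁻ z, ‖uncurry f z‖ₑ ^ q ∂((volume.restrict (Ioo 0 T)).prod volume)) ∧
      (∫⁻ z, ‖(f z.1 ⋆ mollifierKernel φ ε) z.2 - f z.1 z.2‖ₑ ^ q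
          ∂((volume.restrict (Ioo 0 T)).prod volume) =
        ∫⁻ z, ‖(∫ ξ, FluidPDE.mollifierScale ε φ ξ • f z.1 (z.2 + FunctionSpaces.Torus.proj ξ)) - f z.1 z.2‖ₑ ^ q
          ∂((volume.restrict (Ioo 0 T)).prod volume)) := by
  have hbr := ae_convolution_mollifierKernel_eq (T := T) hφ.1 hε hfi
  have hm := aestronglyMeasurable_kernelAverage (T := T) (hφ.1.mollifierScale hε).1.continuous hf
  refine ⟨hm.congr (hbr.mono fun z hz => hz.symm), ?_, ?_⟩
  · calc ∫⁻ z, ‖(f z.1 ⋆ mollifierKernel φ ε) z.2‖ₑ ^ q ∂((volume.restrict (Ioo 0 T)).prod volume)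
        = ∫⁻ z, ‖(∫ ξ, FluidPDE.mollifierScale ε φ ξ • f z.1 (z.2 + FunctionSpaces.Torus.proj ξ))‖ₑ ^ q
            ∂((volume.restrict (Ioo 0 T)).prod volume) :=
          lintegral_congr_ae (hbr.mono fun z hz => by simp only [hz])
      _ ≤ _ := lintegral_enorm_kernelAverage_rpow_le hφ hε hf hq
  · exact lintegral_congr_ae (hbr.mono fun z hz => by simp only [hz])

end MollifiedFields

/-! ## The pressure pairing of the symmetric test field -/

section PressurePairing

variable [DecidableEq d]

/-- **The pressure pairing of the symmetric field, rewritten** (slice-wise): for `u ∈ L¹` weakly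
divergence free, `p ∈ L¹`, smooth even `K` and smooth `χ`,
`∫ p div Φ = ∫ p ⟪u ⋆ K, ∇χ⟫ + ∫ (p ⋆ K) ⟪u, ∇χ⟫`
(`divergence_symmTestField` and the adjointness of `⋆ K` for even `K`,
`Torus.integral_mul_convolution_comm`). [folklore] -/
theorem integral_mul_divergence_symmTestField {u : UnitAddTorus d → EuclideanSpace ℝ d}
    (hu : Integrable u volume) (hdiv : FunctionSpaces.Torus.IsWeaklyDivFree u)
    {p : UnitAddTorus d → ℝ} (hp : Integrable p volume) {K : UnitAddTorus d → ℝ}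
    (hK : FunctionSpaces.Torus.IsSmooth K) (hKev : ∀ z, K (-z) = K z)
    {χ : UnitAddTorus d → ℝ} (hχ : FunctionSpaces.Torus.IsSmooth χ) :
    ∫ x, p x * FunctionSpaces.Torus.divergence (symmTestField K χ u) x =
      (∫ x, p x * ⟪vecConv u K x, FunctionSpaces.Torus.gradient χ x⟫) +
        ∫ x, (p ⋆ K) x * ⟪u x, FunctionSpaces.Torus.gradient χ x⟫ := by
  obtain ⟨Cg, hCg⟩ := FunctionSpaces.Torus.exists_forall_norm_le_of_continuous hχ.gradient.continuous
  -- the two pieces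
  have hVs : ∀ i, FunctionSpaces.Torus.IsSmooth fun y => vecConv u K y i := fun i => by
    have : (fun y => vecConv u K y i) = (fun y => u y i) ⋆ K := by funext y; simp [vecConv_apply]
    rw [this]; exact FunctionSpaces.Torus.isSmooth_convolution (hu.eval_piLp i) hK
  have hVc : Continuous (vecConv u K) := by
    have : vecConv u K = fun y => (WithLp.equiv 2 (d → ℝ)).symm fun i => vecConv u K y i := by
      funext y; rfl
    rw [this]
    exact (PiLp.continuous_toLp 2 _).comp (continuous_pi fun i => (hVs i).continuous)
  obtain ⟨CV, hCV⟩ := FunctionSpaces.Torus.exists_forall_norm_le_of_continuous hVc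
  have hg : Integrable (fun x => ⟪u x, FunctionSpaces.Torus.gradient χ x⟫) volume :=
    (hu.norm.mul_const Cg).mono' (hu.aestronglyMeasurable.inner hχ.gradient.continuous.aestronglyMeasurable)
      (ae_of_all _ fun y => (norm_inner_le_norm _ _).trans (by gcongr; exact hCg y))
  have hgK : Continuous ((fun x => ⟪u x, FunctionSpaces.Torus.gradient χ x⟫) ⋆ K) :=
    FunctionSpaces.Torus.continuous_convolution hg hK.continuous
  obtain ⟨CgK, hCgK⟩ := FunctionSpaces.Torus.exists_forall_norm_le_of_continuous hgK
  have I1 : Integrable (fun x => p x * ⟪vecConv u K x, FunctionSpaces.Torus.gradient χ x⟫) volume := by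
    refine (hp.norm.mul_const (CV * Cg)).mono'
      (hp.aestronglyMeasurable.mul (hVc.aestronglyMeasurable.inner hχ.gradient.continuous.aestronglyMeasurable))
      (ae_of_all _ fun x => ?_)
    rw [norm_mul]
    gcongr
    exact (norm_inner_le_norm _ _).trans (mul_le_mul (hCV x) (hCg x) (norm_nonneg _) ((norm_nonneg _).trans (hCV x)))
  have I2 : Integrable (fun x => p x * ((fun x => ⟪u x, FunctionSpaces.Torus.gradient χ x⟫) ⋆ K) x) volume := by
    refine (hp.norm.mul_const CgK).mono' (hp.aestronglyMeasurable.mul hgK.aestronglyMeasurable)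
      (ae_of_all _ fun x => ?_)
    rw [norm_mul]
    gcongr
    exact hCgK x
  have hpt : ∀ x, p x * FunctionSpaces.Torus.divergence (symmTestField K χ u) x =
      p x * ⟪vecConv u K x, FunctionSpaces.Torus.gradient χ x⟫ +
        p x * ((fun x => ⟪u x, FunctionSpaces.Torus.gradient χ x⟫) ⋆ K) x := fun x => by
    rw [divergence_symmTestField hK hχ hu hdiv x, mul_add]
  simp_rw [hpt]
  rw [integral_add I1 I2, FunctionSpaces.Torus.integral_mul_convolution_comm hp hg hK.continuous hKev]

end PressurePairing

/-! ## Generic glue for the term estimates -/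

section Glue

variable {α : Type*} [MeasurableSpace α] {μ : Measure α}

/-- `|∫ a − ∫ b| ≤ ∫⁻ ‖a − b‖ₑ` (in `ℝ≥0∞`) for integrable real `a`, `b`. [folklore] -/
theorem ofReal_abs_integral_sub_integral_le {a b : α → ℝ} (ha : Integrable a μ) (hb : Integrable b μ) :
    ENNReal.ofReal |(∫ z, a z ∂μ) - ∫ z, b z ∂μ| ≤ ∫⁻ z, ‖a z - b z‖ₑ ∂μ := by
  rw [← integral_sub ha hb, ← Real.enorm_eq_ofReal_abs]
  exact enorm_integral_le_lintegral_enorm _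

/-- An a.e. pointwise bound `‖f‖ ≤ C ‖g‖` by an integrable `g` makes a measurable `f` integrable. [folklore] -/
theorem integrable_of_norm_le_const_mul {E' G' : Type*} [NormedAddCommGroup E'] [NormedAddCommGroup G']
    {f : α → E'} {g : α → G'} (hfm : AEStronglyMeasurable f μ) (hg : Integrable g μ) {C : ℝ}
    (h : ∀ᵐ z ∂μ, ‖f z‖ ≤ C * ‖g z‖) : Integrable f μ :=
  (hg.norm.const_mul C).mono' hfm h

/-- Integrability from a finite lower integral of a product bound: if `‖f‖ ≤ C · F · G` a.e. with
`∫⁻ F G < ∞` then `f` is integrable. [folklore] -/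
theorem integrable_of_enorm_le_mul {E' : Type*} [NormedAddCommGroup E'] {f : α → E'}
    (hfm : AEStronglyMeasurable f μ) {F G : α → ℝ≥0∞} {C : ℝ≥0∞} (hC : C ≠ ⊤)
    (h : ∀ᵐ z ∂μ, ‖f z‖ₑ ≤ C * (F z * G z)) (hFG : ∫⁻ z, F z * G z ∂μ < ⊤) : Integrable f μ := by
  refine ⟨hfm, ?_⟩
  calc ∫⁻ z, ‖f z‖ₑ ∂μ ≤ ∫⁻ z, C * (F z * G z) ∂μ := lintegral_mono_ae h
    _ = C * ∫⁻ z, F z * G z ∂μ := lintegral_const_mul' _ _ hC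
    _ < ⊤ := ENNReal.mul_lt_top hC.lt_top hFG

end Glue

/-! ## Numeric helpers in `ℝ≥0∞` -/

section Numeric

/-- `(3/2).toReal = 3/2`. [folklore] -/
theorem toReal_threeHalves : ((3 : ℝ≥0∞) / 2).toReal = 3 / 2 := by
  rw [ENNReal.toReal_div]; norm_num

/-- `‖ ‖v‖² • v ‖ₑ = ‖v‖ₑ³`. [folklore] -/
theorem enorm_norm_sq_smul {F : Type*} [NormedAddCommGroup F] [NormedSpace ℝ F] (v : F) :
    ‖‖v‖ ^ 2 • v‖ₑ = ‖v‖ₑ ^ 3 := by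
  rw [enorm_smul, enorm_norm_pow]; ring

/-- The triangle inequality behind the final combination of the six term estimates. [folklore] -/
theorem abs_quarter_comb_le (x₁ x₂ x₃ x₅ x₆ x₇ : ℝ) :
    |4⁻¹ * ((x₁ - x₂ + 2 * x₃) + 2 * (x₅ + (x₆ + x₇)))| ≤
      4⁻¹ * (|x₁| + |x₂| + 2 * |x₃| + 2 * (|x₅| + (|x₆| + |x₇|))) := by
  rw [abs_mul, abs_of_pos (by norm_num : (0 : ℝ) < 4⁻¹)]
  gcongr
  calc |x₁ - x₂ + 2 * x₃ + 2 * (x₅ + (x₆ + x₇))|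
      ≤ |x₁ - x₂ + 2 * x₃| + |2 * (x₅ + (x₆ + x₇))| := abs_add_le _ _
    _ ≤ (|x₁ - x₂| + |2 * x₃|) + 2 * |x₅ + (x₆ + x₇)| := by
        gcongr
        · exact abs_add_le _ _
        · rw [abs_mul, abs_of_pos (by norm_num : (0 : ℝ) < 2)]
    _ ≤ ((|x₁| + |x₂|) + 2 * |x₃|) + 2 * (|x₅| + (|x₆| + |x₇|)) := by
        gcongr
        · exact abs_sub _ _
        · rw [abs_mul, abs_of_pos (by norm_num : (0 : ℝ) < 2)]
        · exact (abs_add_le _ _).trans (add_le_add le_rfl (abs_add_le _ _))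
    _ = _ := by ring

/-- `ofReal` of the combination. [folklore] -/
theorem ofReal_quarter_comb (y₁ y₂ y₃ y₅ y₆ y₇ : ℝ) (h₁ : 0 ≤ y₁) (h₂ : 0 ≤ y₂) (h₃ : 0 ≤ y₃) (h₅ : 0 ≤ y₅)
    (h₆ : 0 ≤ y₆) (h₇ : 0 ≤ y₇) :
    ENNReal.ofReal (4⁻¹ * (y₁ + y₂ + 2 * y₃ + 2 * (y₅ + (y₆ + y₇)))) =
      4⁻¹ * (ENNReal.ofReal y₁ + ENNReal.ofReal y₂ + 2 * ENNReal.ofReal y₃ +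
        2 * (ENNReal.ofReal y₅ + (ENNReal.ofReal y₆ + ENNReal.ofReal y₇))) := by
  rw [ENNReal.ofReal_mul (by norm_num), ENNReal.ofReal_inv_of_pos (by norm_num), ENNReal.ofReal_ofNat,
    ENNReal.ofReal_add (by positivity) (by positivity), ENNReal.ofReal_add (by positivity) (by positivity),
    ENNReal.ofReal_add h₁ h₂, ENNReal.ofReal_mul (by norm_num), ENNReal.ofReal_ofNat,
    ENNReal.ofReal_mul (by norm_num), ENNReal.ofReal_ofNat, ENNReal.ofReal_add h₅ (by positivity),
    ENNReal.ofReal_add h₆ h₇]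

/-- `‖⟪a, b⟫‖ₑ ≤ ‖a‖ₑ ‖b‖ₑ` (Cauchy–Schwarz in `ℝ≥0∞` form). [folklore] -/
theorem enorm_inner_le_mul {E' : Type*} [NormedAddCommGroup E'] [InnerProductSpace ℝ E'] (a b : E') :
    ‖⟪a, b⟫‖ₑ ≤ ‖a‖ₑ * ‖b‖ₑ := by
  rw [← ofReal_norm, ← ofReal_norm, ← ofReal_norm, ← ENNReal.ofReal_mul (norm_nonneg _)]
  exact ENNReal.ofReal_le_ofReal (norm_inner_le_norm a b)

/-- `(x²)^{3/2} = x³` in `ℝ≥0∞` (real exponents). [folklore] -/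
theorem rpow_two_rpow_threeHalves (x : ℝ≥0∞) : (x ^ (2 : ℝ)) ^ (3 / 2 : ℝ) = x ^ (3 : ℝ) := by
  rw [← ENNReal.rpow_mul]; norm_num

/-- `x ^ (3:ℝ) = x ^ 3`. [folklore] -/
theorem rpow_three_eq_pow (x : ℝ≥0∞) : x ^ (3 : ℝ) = x ^ 3 := by
  rw [show (3 : ℝ) = ((3 : ℕ) : ℝ) by norm_num, ENNReal.rpow_natCast]

end Numeric

/-! ## The scale-`ε` estimate -/

section ScaleEstimate

variable [DecidableEq d] {T : ℝ} {u : ℝ → UnitAddTorus d → EuclideanSpace ℝ d} {p : ℝ → UnitAddTorus d → ℝ}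
  {ψ : ℝ → UnitAddTorus d → ℝ}

set_option maxHeartbeats 1600000 in
/-- **The Duchon–Robert pairing minus the local energy flux, at scale `ε`.** For a distributional
Euler solution `(u, p)` with `u ∈ L³`, `p ∈ L^{3/2}`, a test function `ψ` supported in `(0,T)`
with `|∂ₜψ| ≤ C₁`, `|∇ψ| ≤ C₂` on `[0,T]`, a unit-ball mollifier `φ` and `ε > 0`, granted the
cubic identity and the tested momentum equation (`DuchonRobertLocalBalance`):
`|∫∫ D_ε ψ − ∫∫[½|u|²∂ₜψ + (½|u|²+p)⟪u,∇ψ⟫]|` is at most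
`¼ [C₂ δ_w + C₂ δ_s^{2/3} U₃^{1/3} + 2 C₂ U₃^{2/3} δ_u^{1/3} + 2 (C₁ U₂^{1/2} (δ'_u)^{1/2} + C₂ P^{2/3} δ_u^{1/3} + C₂ δ_p^{2/3} U₃^{1/3})]`,
where `U₃ ≥ ∫∫|u|³`, `U₂ ≥ ∫∫|u|²`, `P ≥ ∫∫|p|^{3/2}` and the `δ`'s bound the kernel-average
deviations `∫∫ |u^ε − u|³`, `∫∫|u^ε − u|²`, `∫∫ |(|u|²)^ε − |u|²|^{3/2}`, `∫∫ |(|u|²u)^ε − |u|²u|`,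
`∫∫|p^ε − p|^{3/2}`. (At scale `ε`: `4∫∫D_εψ = A₁ − A₂ + 2A₃ + 2(A₅ + A₆)` by the two facts and
`four_mul_duchonRobertApprox_eq_kernelFlux`; each `Aᵢ` minus its limit is a deviation paired
with fixed factors, estimated by Hölder.) [folklore] -/
theorem ofReal_abs_duchonRobert_sub_flux_le
    (hAlg : integral_kernelFlux_mul_eq (d := d))
    (hEq : IsDistributionalNSSolutionOn.symmTestField_identity (d := d))
    (hsol : IsDistributionalNSSolutionOn T 0 0 u p)
    (hu3 : ∫⁻ t in Ioo 0 T, ∫⁻ x, ‖u t x‖ₑ ^ 3 < ⊤)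
    (hp : ∫⁻ t in Ioo 0 T, ∫⁻ x, ‖p t x‖ₑ ^ (3 / 2 : ℝ) < ⊤)
    (hψ : FunctionSpaces.Torus.IsSpaceTimeTestIoo T ψ)
    {Cdt Cgr : ℝ} (hCdt : ∀ t ∈ Icc 0 T, ∀ x, ‖FunctionSpaces.Torus.timeDeriv ψ t x‖ ≤ Cdt)
    (hCgr : ∀ t ∈ Icc 0 T, ∀ x, ‖FunctionSpaces.Torus.gradient (ψ t) x‖ ≤ Cgr)
    {φ : EuclideanSpace ℝ d → ℝ} (hφ : IsUnitBallMollifier φ) {ε : ℝ} (hε : 0 < ε)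
    {U3 U2 P Du3 Du2 Ds Dw Dp : ℝ≥0∞} (hU3t : U3 ≠ ⊤) (hU2t : U2 ≠ ⊤) (hPt : P ≠ ⊤)
    (hU3 : ∫⁻ z, ‖u z.1 z.2‖ₑ ^ (3 : ℝ) ∂((volume.restrict (Ioo 0 T)).prod volume) ≤ U3)
    (hU2 : ∫⁻ z, ‖u z.1 z.2‖ₑ ^ (2 : ℝ) ∂((volume.restrict (Ioo 0 T)).prod volume) ≤ U2)
    (hP : ∫⁻ z, ‖p z.1 z.2‖ₑ ^ (3 / 2 : ℝ) ∂((volume.restrict (Ioo 0 T)).prod volume) ≤ P)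
    (hDu3 : ∫⁻ z, ‖(∫ ξ, FluidPDE.mollifierScale ε φ ξ • u z.1 (z.2 + FunctionSpaces.Torus.proj ξ)) - u z.1 z.2‖ₑ ^ (3 : ℝ)
      ∂((volume.restrict (Ioo 0 T)).prod volume) ≤ Du3)
    (hDu2 : ∫⁻ z, ‖(∫ ξ, FluidPDE.mollifierScale ε φ ξ • u z.1 (z.2 + FunctionSpaces.Torus.proj ξ)) - u z.1 z.2‖ₑ ^ (2 : ℝ)
      ∂((volume.restrict (Ioo 0 T)).prod volume) ≤ Du2)
    (hDs : ∫⁻ z, ‖(∫ ξ, FluidPDE.mollifierScale ε φ ξ • ‖u z.1 (z.2 + FunctionSpaces.Torus.proj ξ)‖ ^ 2) - ‖u z.1 z.2‖ ^ 2‖ₑ ^ (3 / 2 : ℝ)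
      ∂((volume.restrict (Ioo 0 T)).prod volume) ≤ Ds)
    (hDw : ∫⁻ z, ‖(∫ ξ, FluidPDE.mollifierScale ε φ ξ • (‖u z.1 (z.2 + FunctionSpaces.Torus.proj ξ)‖ ^ 2 • u z.1 (z.2 + FunctionSpaces.Torus.proj ξ))) -
        ‖u z.1 z.2‖ ^ 2 • u z.1 z.2‖ₑ ^ (1 : ℝ) ∂((volume.restrict (Ioo 0 T)).prod volume) ≤ Dw)
    (hDp : ∫⁻ z, ‖(∫ ξ, FluidPDE.mollifierScale ε φ ξ • p z.1 (z.2 + FunctionSpaces.Torus.proj ξ)) - p z.1 z.2‖ₑ ^ (3 / 2 : ℝ)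
      ∂((volume.restrict (Ioo 0 T)).prod volume) ≤ Dp) :
    ENNReal.ofReal |(∫ t in Ioo 0 T, ∫ x, duchonRobertApprox φ ε (u t) x * ψ t x) -
        ∫ t in Ioo 0 T, ∫ x, (2⁻¹ * ‖u t x‖ ^ 2 * FunctionSpaces.Torus.timeDeriv ψ t x +
          (2⁻¹ * ‖u t x‖ ^ 2 + p t x) * ⟪u t x, FunctionSpaces.Torus.gradient (ψ t) x⟫)| ≤
      4⁻¹ * (ENNReal.ofReal Cgr * Dw + ENNReal.ofReal Cgr * (Ds ^ (2 / 3 : ℝ) * U3 ^ (1 / 3 : ℝ)) +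
        2 * (ENNReal.ofReal Cgr * (U3 ^ (2 / 3 : ℝ) * Du3 ^ (1 / 3 : ℝ))) +
        2 * (ENNReal.ofReal Cdt * (U2 ^ (1 / 2 : ℝ) * Du2 ^ (1 / 2 : ℝ)) +
          (ENNReal.ofReal Cgr * (P ^ (2 / 3 : ℝ) * Du3 ^ (1 / 3 : ℝ)) +
            ENNReal.ofReal Cgr * (Dp ^ (2 / 3 : ℝ) * U3 ^ (1 / 3 : ℝ))))) := by
  set μT := (volume.restrict (Ioo 0 T)).prod (volume : Measure (UnitAddTorus d)) with hμT
  set K : UnitAddTorus d → ℝ := mollifierKernel φ ε with hKdef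
  have hK : FunctionSpaces.Torus.IsSmooth K := isSmooth_mollifierKernel hφ.1 hε
  have hKev : ∀ z, K (-z) = K z := mollifierKernel_neg hφ.1 ε
  -- Step 0: data
  have hum : AEStronglyMeasurable (uncurry u) μT := aestronglyMeasurable_uncurry_prod hsol.1
  have hpm : AEStronglyMeasurable (uncurry p) μT := aestronglyMeasurable_uncurry_prod hsol.2.2.1
  have hdiv : ∀ᵐ t ∂(volume.restrict (Ioo 0 T)), FunctionSpaces.Torus.IsWeaklyDivFree (u t) :=
    hsol.2.2.2.2.1
  have hu3M : MemLqLp 3 3 u (Ioo 0 T) := by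
    refine memLqLp_of_lintegral_lt_top three_ne_zero ENNReal.ofNat_ne_top hum ?_
    simpa only [ENNReal.toReal_ofNat, ENNReal.rpow_ofNat] using hu3
  have hL3t : ∀ᵐ t ∂(volume.restrict (Ioo 0 T)), MemLp (u t) 3 volume := hu3M.1
  have hIu : ∀ᵐ t ∂(volume.restrict (Ioo 0 T)), Integrable (u t) volume :=
    hL3t.mono fun t ht => ht.integrable (by norm_num)
  have hp32M : MemLqLp (3 / 2) (3 / 2) p (Ioo 0 T) := by
    refine memLqLp_of_lintegral_lt_top (by norm_num) FunctionSpaces.ennreal_three_halves_ne_top hpm ?_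
    simpa only [toReal_threeHalves] using hp
  have hIp : ∀ᵐ t ∂(volume.restrict (Ioo 0 T)), Integrable (p t) volume :=
    hp32M.1.mono fun t ht => ht.integrable FunctionSpaces.ennreal_one_le_three_halves
  have hsm : AEStronglyMeasurable (uncurry fun t x => ‖u t x‖ ^ 2) μT := hum.norm.pow 2
  have hwm : AEStronglyMeasurable (uncurry fun t x => ‖u t x‖ ^ 2 • u t x) μT := hsm.smul hum
  have hIs : ∀ᵐ t ∂(volume.restrict (Ioo 0 T)), Integrable (fun x => ‖u t x‖ ^ 2) volume :=
    hL3t.mono fun t ht => (memLp_two_iff_integrable_sq_norm ht.1).1 (ht.mono_exponent (by norm_num))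
  have hIw : ∀ᵐ t ∂(volume.restrict (Ioo 0 T)), Integrable (fun x => ‖u t x‖ ^ 2 • u t x) volume := by
    filter_upwards [hL3t] with t ht
    have h3 : Integrable (fun x => ‖u t x‖ ^ (3 : ℝ)) volume := by
      simpa [ENNReal.toReal_ofNat] using ht.integrable_norm_rpow three_ne_zero ENNReal.ofNat_ne_top
    refine h3.mono' ((ht.1.norm.pow 2).smul ht.1) (ae_of_all _ fun x => le_of_eq ?_)
    rw [norm_smul, Real.norm_eq_abs, abs_of_nonneg (sq_nonneg _), show (3 : ℝ) = ((3 : ℕ) : ℝ) by norm_num,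
      Real.rpow_natCast]
    ring
  -- test-field data
  have hψs : ∀ t, FunctionSpaces.Torus.IsSmooth (ψ t) := hψ.isSpaceTimeTest.isSmooth_slice
  obtain ⟨-, hdt, hgr, -⟩ := hψ.isSpaceTimeTest.isSmoothSpaceTimeOn_derived
  have hdtm : AEStronglyMeasurable (uncurry (FunctionSpaces.Torus.timeDeriv ψ)) μT := (hdt.bound_and_measurable T).2
  have hgrm : AEStronglyMeasurable (uncurry fun t => FunctionSpaces.Torus.gradient (ψ t)) μT :=
    (hgr.bound_and_measurable T).2
  have hIoo : ∀ᵐ z ∂μT, z.1 ∈ Ioo 0 T := by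
    rw [hμT, ← volume_restrict_Ioo_prod_univ]
    filter_upwards [ae_restrict_mem (measurableSet_Ioo.prod MeasurableSet.univ)] with z hz
    exact hz.1
  -- Step 1: the identity at scale `ε` (the two facts and the unfolding of `D_ε`)
  have key : (∫ t in Ioo 0 T, ∫ x, duchonRobertApprox φ ε (u t) x * ψ t x) =
      4⁻¹ * (((∫ t in Ioo 0 T, ∫ x,
          ⟪vecConv (fun y => ‖u t y‖ ^ 2 • u t y) K x, FunctionSpaces.Torus.gradient (ψ t) x⟫) -
        (∫ t in Ioo 0 T, ∫ x,
          ((fun y => ‖u t y‖ ^ 2) ⋆ K) x * ⟪u t x, FunctionSpaces.Torus.gradient (ψ t) x⟫) +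
        2 * (∫ t in Ioo 0 T, ∫ x,
          ⟪u t x, vecConv (u t) K x⟫ * ⟪u t x, FunctionSpaces.Torus.gradient (ψ t) x⟫)) +
        2 * (((∫ t in Ioo 0 T, ∫ x, ⟪u t x, vecConv (u t) K x⟫ * FunctionSpaces.Torus.timeDeriv ψ t x) +
          0 * (∫ t in Ioo 0 T, ∫ x, ⟪u t x, FunctionSpaces.Torus.laplacian (symmTestField K (ψ t) (u t)) x⟫)) +
          (∫ t in Ioo 0 T, ∫ x, p t x * FunctionSpaces.Torus.divergence (symmTestField K (ψ t) (u t)) x))) := by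
    have h2 := hAlg hsol.1 hu3 hdiv hK hKev hψ
    have h3 := hEq hsol hu3 hp hK hKev hψ
    have h1 : (∫ t in Ioo 0 T, ∫ x, duchonRobertApprox φ ε (u t) x * ψ t x) =
        4⁻¹ * ∫ t in Ioo 0 T, ∫ x, kernelFlux K (u t) x * ψ t x := by
      rw [← integral_const_mul]
      refine integral_congr_ae (hL3t.mono fun t ht => ?_)
      dsimp only
      rw [← integral_const_mul]
      refine integral_congr_ae (ae_of_all _ fun x => ?_)
      dsimp only
      rw [hKdef, ← four_mul_duchonRobertApprox_eq_kernelFlux hφ.1 hε ht x]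
      ring
    rw [h1, h2]
    linear_combination (-(2:ℝ) * 4⁻¹) * h3
  -- Step 2: the mollified fields
  obtain ⟨huKm, huK3, hδu3⟩ := vecConv_mollifierKernel_facts (T := T) hφ hε hum hIu (q := 3) (by norm_num)
  obtain ⟨-, huK2, hδu2⟩ := vecConv_mollifierKernel_facts (T := T) hφ hε hum hIu (q := 2) (by norm_num)
  obtain ⟨hsKm, hsK32, hδs⟩ := convolution_mollifierKernel_facts (T := T) hφ hε hsm hIs (q := 3 / 2) (by norm_num)
  obtain ⟨hwKm, hwK1, hδw⟩ := vecConv_mollifierKernel_facts (T := T) hφ hε hwm hIw (q := 1) le_rfl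
  obtain ⟨hpKm, hpK32, hδp⟩ := convolution_mollifierKernel_facts (T := T) hφ hε hpm hIp (q := 3 / 2) (by norm_num)
  rw [← hKdef] at huKm huK3 hδu3 huK2 hδu2 hsKm hsK32 hδs hwKm hwK1 hδw hpKm hpK32 hδp
  -- fixed-field finiteness on `μT`
  have hU3' : ∫⁻ z, ‖u z.1 z.2‖ₑ ^ (3 : ℝ) ∂μT < ⊤ := by
    have e3 : ∫⁻ t in Ioo 0 T, ∫⁻ x, ‖u t x‖ₑ ^ (3 : ℕ) = ∫⁻ z, ‖u z.1 z.2‖ₑ ^ (3 : ℕ) ∂μT :=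
      lintegral_Ioo_lintegral_eq_lintegral_prod (g := fun t x => ‖u t x‖ₑ ^ (3 : ℕ)) (hum.enorm.pow_const _)
    simp_rw [rpow_three_eq_pow]
    rw [← e3]
    exact hu3
  have hU2' : ∫⁻ z, ‖u z.1 z.2‖ₑ ^ (2 : ℝ) ∂μT < ⊤ := by
    have e2 : ∫⁻ t in Ioo 0 T, ∫⁻ x, ‖u t x‖ₑ ^ (2 : ℕ) = ∫⁻ z, ‖u z.1 z.2‖ₑ ^ (2 : ℕ) ∂μT :=
      lintegral_Ioo_lintegral_eq_lintegral_prod (g := fun t x => ‖u t x‖ₑ ^ (2 : ℕ)) (hum.enorm.pow_const _)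
    simp_rw [ENNReal.rpow_two]
    rw [← e2]
    exact hsol.2.1
  have hP' : ∫⁻ z, ‖p z.1 z.2‖ₑ ^ (3 / 2 : ℝ) ∂μT < ⊤ := by
    have e := lintegral_Ioo_lintegral_eq_lintegral_prod (g := fun t x => ‖p t x‖ₑ ^ (3 / 2 : ℝ))
      (hpm.enorm.pow_const _)
    rw [← e]
    exact hp
  have hS' : ∫⁻ z, ‖‖u z.1 z.2‖ ^ 2‖ₑ ^ (3 / 2 : ℝ) ∂μT = ∫⁻ z, ‖u z.1 z.2‖ₑ ^ (3 : ℝ) ∂μT :=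
    lintegral_congr fun z => by rw [enorm_norm_pow, ← ENNReal.rpow_two, rpow_two_rpow_threeHalves]
  have hW' : ∫⁻ z, ‖‖u z.1 z.2‖ ^ 2 • u z.1 z.2‖ₑ ^ (1 : ℝ) ∂μT = ∫⁻ z, ‖u z.1 z.2‖ₑ ^ (3 : ℝ) ∂μT :=
    lintegral_congr fun z => by rw [ENNReal.rpow_one, enorm_norm_sq_smul, rpow_three_eq_pow]
  -- the mollified fields are in the same classes
  have huK3' : ∫⁻ z, ‖vecConv (u z.1) K z.2‖ₑ ^ (3 : ℝ) ∂μT ≤ U3 := huK3.trans hU3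
  have huK2' : ∫⁻ z, ‖vecConv (u z.1) K z.2‖ₑ ^ (2 : ℝ) ∂μT ≤ U2 := huK2.trans hU2
  have hsK32' : ∫⁻ z, ‖((fun y => ‖u z.1 y‖ ^ 2) ⋆ K) z.2‖ₑ ^ (3 / 2 : ℝ) ∂μT ≤ U3 :=
    hsK32.trans (hS'.le.trans hU3)
  have hwK1' : ∫⁻ z, ‖vecConv (fun y => ‖u z.1 y‖ ^ 2 • u z.1 y) K z.2‖ₑ ∂μT ≤ U3 := by
    have := hwK1.trans (hW'.le.trans hU3)
    simpa only [ENNReal.rpow_one] using this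
  have hpK32' : ∫⁻ z, ‖(p z.1 ⋆ K) z.2‖ₑ ^ (3 / 2 : ℝ) ∂μT ≤ P := hpK32.trans hP
  -- Step 3: pointwise bounds on the weights (a.e. on `μT`) and integrability of the integrands
  have hGb : ∀ᵐ z ∂μT, ‖FunctionSpaces.Torus.gradient (ψ z.1) z.2‖ₑ ≤ ENNReal.ofReal Cgr := by
    filter_upwards [hIoo] with z hz
    rw [← ofReal_norm]
    exact ENNReal.ofReal_le_ofReal (hCgr z.1 (Ioo_subset_Icc_self hz) z.2)
  have hθb : ∀ᵐ z ∂μT, ‖FunctionSpaces.Torus.timeDeriv ψ z.1 z.2‖ₑ ≤ ENNReal.ofReal Cdt := by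
    filter_upwards [hIoo] with z hz
    rw [← ofReal_norm]
    exact ENNReal.ofReal_le_ofReal (hCdt z.1 (Ioo_subset_Icc_self hz) z.2)
  have hCg : ENNReal.ofReal Cgr ≠ ⊤ := ENNReal.ofReal_ne_top
  have hCd : ENNReal.ofReal Cdt ≠ ⊤ := ENNReal.ofReal_ne_top
  -- finiteness of the relevant product lower integrals (Hölder)
  have fin_uK_u2 : ∫⁻ z, ‖u z.1 z.2‖ₑ ^ (2 : ℝ) * ‖vecConv (u z.1) K z.2‖ₑ ∂μT ≤
      U3 ^ (2 / 3 : ℝ) * U3 ^ (1 / 3 : ℝ) := by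
    refine (lintegral_mul_le_L32_mul_L3 μT ((hum.enorm.pow_const _)) huKm.enorm).trans ?_
    refine mul_le_mul' (ENNReal.rpow_le_rpow ?_ (by norm_num)) (ENNReal.rpow_le_rpow huK3' (by norm_num))
    calc ∫⁻ z, (‖uncurry u z‖ₑ ^ (2 : ℝ)) ^ (3 / 2 : ℝ) ∂μT = ∫⁻ z, ‖u z.1 z.2‖ₑ ^ (3 : ℝ) ∂μT :=
          lintegral_congr fun z => rpow_two_rpow_threeHalves _
      _ ≤ U3 := hU3
  have fin_uK_u : ∫⁻ z, ‖u z.1 z.2‖ₑ * ‖vecConv (u z.1) K z.2‖ₑ ∂μT ≤ U2 ^ (1 / 2 : ℝ) * U2 ^ (1 / 2 : ℝ) :=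
    (lintegral_mul_le_sqrt_mul_sqrt μT hum.enorm huKm.enorm).trans
      (mul_le_mul' (ENNReal.rpow_le_rpow hU2 (by norm_num)) (ENNReal.rpow_le_rpow huK2' (by norm_num)))
  have fin_p_uK : ∫⁻ z, ‖p z.1 z.2‖ₑ * ‖vecConv (u z.1) K z.2‖ₑ ∂μT ≤ P ^ (2 / 3 : ℝ) * U3 ^ (1 / 3 : ℝ) :=
    (lintegral_mul_le_L32_mul_L3 μT hpm.enorm huKm.enorm).trans
      (mul_le_mul' (ENNReal.rpow_le_rpow hP (by norm_num)) (ENNReal.rpow_le_rpow huK3' (by norm_num)))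
  have fin_pK_u : ∫⁻ z, ‖(p z.1 ⋆ K) z.2‖ₑ * ‖u z.1 z.2‖ₑ ∂μT ≤ P ^ (2 / 3 : ℝ) * U3 ^ (1 / 3 : ℝ) :=
    (lintegral_mul_le_L32_mul_L3 μT hpKm.enorm hum.enorm).trans
      (mul_le_mul' (ENNReal.rpow_le_rpow hpK32' (by norm_num)) (ENNReal.rpow_le_rpow hU3 (by norm_num)))
  have fin_sK_u : ∫⁻ z, ‖((fun y => ‖u z.1 y‖ ^ 2) ⋆ K) z.2‖ₑ * ‖u z.1 z.2‖ₑ ∂μT ≤ U3 ^ (2 / 3 : ℝ) * U3 ^ (1 / 3 : ℝ) :=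
    (lintegral_mul_le_L32_mul_L3 μT hsKm.enorm hum.enorm).trans
      (mul_le_mul' (ENNReal.rpow_le_rpow hsK32' (by norm_num)) (ENNReal.rpow_le_rpow hU3 (by norm_num)))
  -- finiteness
  have hrt : ∀ {x : ℝ≥0∞} {r : ℝ}, 0 ≤ r → x ≠ ⊤ → x ^ r ≠ ⊤ := fun hr hx => ENNReal.rpow_ne_top_of_nonneg hr hx
  have ltU33 : U3 ^ (2 / 3 : ℝ) * U3 ^ (1 / 3 : ℝ) < ⊤ :=
    ENNReal.mul_lt_top (hrt (by norm_num) hU3t).lt_top (hrt (by norm_num) hU3t).lt_top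
  have ltU22 : U2 ^ (1 / 2 : ℝ) * U2 ^ (1 / 2 : ℝ) < ⊤ :=
    ENNReal.mul_lt_top (hrt (by norm_num) hU2t).lt_top (hrt (by norm_num) hU2t).lt_top
  have ltPU : P ^ (2 / 3 : ℝ) * U3 ^ (1 / 3 : ℝ) < ⊤ :=
    ENNReal.mul_lt_top (hrt (by norm_num) hPt).lt_top (hrt (by norm_num) hU3t).lt_top
  -- Step 3b: integrability of the integrands on `μT`
  have hGm : AEStronglyMeasurable (fun z : ℝ × UnitAddTorus d => FunctionSpaces.Torus.gradient (ψ z.1) z.2) μT := hgrm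
  have hθm : AEStronglyMeasurable (fun z : ℝ × UnitAddTorus d => FunctionSpaces.Torus.timeDeriv ψ z.1 z.2) μT := hdtm
  have J1 : Integrable (fun z : ℝ × UnitAddTorus d =>
      ⟪vecConv (fun y => ‖u z.1 y‖ ^ 2 • u z.1 y) K z.2, FunctionSpaces.Torus.gradient (ψ z.1) z.2⟫) μT := by
    refine integrable_of_enorm_le_mul (hwKm.inner hGm) (F := fun z => ‖vecConv (fun y => ‖u z.1 y‖ ^ 2 • u z.1 y) K z.2‖ₑ)
      (G := fun _ => 1) hCg ?_ ?_
    · filter_upwards [hGb] with z hz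
      rw [mul_one, mul_comm]
      exact (enorm_inner_le_mul _ _).trans (mul_le_mul_right hz _)
    · simp only [mul_one]
      exact lt_of_le_of_lt hwK1' hU3t.lt_top
  have J2 : Integrable (fun z : ℝ × UnitAddTorus d =>
      ((fun y => ‖u z.1 y‖ ^ 2) ⋆ K) z.2 * ⟪u z.1 z.2, FunctionSpaces.Torus.gradient (ψ z.1) z.2⟫) μT := by
    refine integrable_of_enorm_le_mul (hsKm.mul (hum.inner hGm)) hCg ?_ (lt_of_le_of_lt fin_sK_u ltU33)
    filter_upwards [hGb] with z hz
    rw [enorm_mul]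
    calc ‖((fun y => ‖u z.1 y‖ ^ 2) ⋆ K) z.2‖ₑ * ‖⟪u z.1 z.2, FunctionSpaces.Torus.gradient (ψ z.1) z.2⟫‖ₑ
        ≤ ‖((fun y => ‖u z.1 y‖ ^ 2) ⋆ K) z.2‖ₑ * (‖u z.1 z.2‖ₑ * ENNReal.ofReal Cgr) := by
          gcongr; exact (enorm_inner_le_mul _ _).trans (mul_le_mul_right hz _)
      _ = ENNReal.ofReal Cgr * (‖((fun y => ‖u z.1 y‖ ^ 2) ⋆ K) z.2‖ₑ * ‖u z.1 z.2‖ₑ) := by ring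
  have J3 : Integrable (fun z : ℝ × UnitAddTorus d =>
      ⟪u z.1 z.2, vecConv (u z.1) K z.2⟫ * ⟪u z.1 z.2, FunctionSpaces.Torus.gradient (ψ z.1) z.2⟫) μT := by
    refine integrable_of_enorm_le_mul ((hum.inner huKm).mul (hum.inner hGm)) hCg ?_ (lt_of_le_of_lt fin_uK_u2 ltU33)
    filter_upwards [hGb] with z hz
    rw [enorm_mul]
    calc ‖⟪u z.1 z.2, vecConv (u z.1) K z.2⟫‖ₑ * ‖⟪u z.1 z.2, FunctionSpaces.Torus.gradient (ψ z.1) z.2⟫‖ₑ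
        ≤ (‖u z.1 z.2‖ₑ * ‖vecConv (u z.1) K z.2‖ₑ) * (‖u z.1 z.2‖ₑ * ENNReal.ofReal Cgr) :=
          mul_le_mul' (enorm_inner_le_mul _ _) ((enorm_inner_le_mul _ _).trans (mul_le_mul_right hz _))
      _ = ENNReal.ofReal Cgr * (‖u z.1 z.2‖ₑ ^ (2 : ℝ) * ‖vecConv (u z.1) K z.2‖ₑ) := by
          rw [ENNReal.rpow_two]; ring
  have J5 : Integrable (fun z : ℝ × UnitAddTorus d =>
      ⟪u z.1 z.2, vecConv (u z.1) K z.2⟫ * FunctionSpaces.Torus.timeDeriv ψ z.1 z.2) μT := by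
    refine integrable_of_enorm_le_mul ((hum.inner huKm).mul hθm) hCd ?_ (lt_of_le_of_lt fin_uK_u ltU22)
    filter_upwards [hθb] with z hz
    rw [enorm_mul]
    calc ‖⟪u z.1 z.2, vecConv (u z.1) K z.2⟫‖ₑ * ‖FunctionSpaces.Torus.timeDeriv ψ z.1 z.2‖ₑ
        ≤ (‖u z.1 z.2‖ₑ * ‖vecConv (u z.1) K z.2‖ₑ) * ENNReal.ofReal Cdt :=
          mul_le_mul' (enorm_inner_le_mul _ _) hz
      _ = ENNReal.ofReal Cdt * (‖u z.1 z.2‖ₑ * ‖vecConv (u z.1) K z.2‖ₑ) := by ring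
  have J6a : Integrable (fun z : ℝ × UnitAddTorus d =>
      p z.1 z.2 * ⟪vecConv (u z.1) K z.2, FunctionSpaces.Torus.gradient (ψ z.1) z.2⟫) μT := by
    refine integrable_of_enorm_le_mul (hpm.mul (huKm.inner hGm)) hCg ?_ (lt_of_le_of_lt fin_p_uK ltPU)
    filter_upwards [hGb] with z hz
    rw [enorm_mul]
    calc ‖p z.1 z.2‖ₑ * ‖⟪vecConv (u z.1) K z.2, FunctionSpaces.Torus.gradient (ψ z.1) z.2⟫‖ₑ
        ≤ ‖p z.1 z.2‖ₑ * (‖vecConv (u z.1) K z.2‖ₑ * ENNReal.ofReal Cgr) := by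
          gcongr; exact (enorm_inner_le_mul _ _).trans (mul_le_mul_right hz _)
      _ = ENNReal.ofReal Cgr * (‖p z.1 z.2‖ₑ * ‖vecConv (u z.1) K z.2‖ₑ) := by ring
  have J6b : Integrable (fun z : ℝ × UnitAddTorus d =>
      (p z.1 ⋆ K) z.2 * ⟪u z.1 z.2, FunctionSpaces.Torus.gradient (ψ z.1) z.2⟫) μT := by
    refine integrable_of_enorm_le_mul (hpKm.mul (hum.inner hGm)) hCg ?_ (lt_of_le_of_lt fin_pK_u ltPU)
    filter_upwards [hGb] with z hz
    rw [enorm_mul]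
    calc ‖(p z.1 ⋆ K) z.2‖ₑ * ‖⟪u z.1 z.2, FunctionSpaces.Torus.gradient (ψ z.1) z.2⟫‖ₑ
        ≤ ‖(p z.1 ⋆ K) z.2‖ₑ * (‖u z.1 z.2‖ₑ * ENNReal.ofReal Cgr) := by
          gcongr; exact (enorm_inner_le_mul _ _).trans (mul_le_mul_right hz _)
      _ = ENNReal.ofReal Cgr * (‖(p z.1 ⋆ K) z.2‖ₑ * ‖u z.1 z.2‖ₑ) := by ring
  -- the limit-side integrands
  obtain ⟨IT, IA, IP⟩ := integrable_flux_pieces hum hu3 hpm hp hdtm hgrm (C := max Cdt Cgr)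
    (fun t ht x => (hCdt t ht x).trans (le_max_left _ _))
    (fun t ht x => (hCgr t ht x).trans (le_max_right _ _))
  -- Step 4: the pairings as product integrals
  have e1 : (∫ t in Ioo 0 T, ∫ x, ⟪vecConv (fun y => ‖u t y‖ ^ 2 • u t y) K x, FunctionSpaces.Torus.gradient (ψ t) x⟫) =
      ∫ z, ⟪vecConv (fun y => ‖u z.1 y‖ ^ 2 • u z.1 y) K z.2, FunctionSpaces.Torus.gradient (ψ z.1) z.2⟫ ∂μT :=
    (integral_prod _ J1).symm
  have e2 : (∫ t in Ioo 0 T, ∫ x, ((fun y => ‖u t y‖ ^ 2) ⋆ K) x * ⟪u t x, FunctionSpaces.Torus.gradient (ψ t) x⟫) =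
      ∫ z, ((fun y => ‖u z.1 y‖ ^ 2) ⋆ K) z.2 * ⟪u z.1 z.2, FunctionSpaces.Torus.gradient (ψ z.1) z.2⟫ ∂μT :=
    (integral_prod _ J2).symm
  have e3 : (∫ t in Ioo 0 T, ∫ x, ⟪u t x, vecConv (u t) K x⟫ * ⟪u t x, FunctionSpaces.Torus.gradient (ψ t) x⟫) =
      ∫ z, ⟪u z.1 z.2, vecConv (u z.1) K z.2⟫ * ⟪u z.1 z.2, FunctionSpaces.Torus.gradient (ψ z.1) z.2⟫ ∂μT :=
    (integral_prod _ J3).symm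
  have e5 : (∫ t in Ioo 0 T, ∫ x, ⟪u t x, vecConv (u t) K x⟫ * FunctionSpaces.Torus.timeDeriv ψ t x) =
      ∫ z, ⟪u z.1 z.2, vecConv (u z.1) K z.2⟫ * FunctionSpaces.Torus.timeDeriv ψ z.1 z.2 ∂μT :=
    (integral_prod _ J5).symm
  have e6 : (∫ t in Ioo 0 T, ∫ x, p t x * FunctionSpaces.Torus.divergence (symmTestField K (ψ t) (u t)) x) =
      (∫ z, p z.1 z.2 * ⟪vecConv (u z.1) K z.2, FunctionSpaces.Torus.gradient (ψ z.1) z.2⟫ ∂μT) +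
        ∫ z, (p z.1 ⋆ K) z.2 * ⟪u z.1 z.2, FunctionSpaces.Torus.gradient (ψ z.1) z.2⟫ ∂μT := by
    have hae : ∀ᵐ t ∂(volume.restrict (Ioo 0 T)),
        (∫ x, p t x * FunctionSpaces.Torus.divergence (symmTestField K (ψ t) (u t)) x) =
          (∫ x, p t x * ⟪vecConv (u t) K x, FunctionSpaces.Torus.gradient (ψ t) x⟫) +
            ∫ x, (p t ⋆ K) x * ⟪u t x, FunctionSpaces.Torus.gradient (ψ t) x⟫ := by
      filter_upwards [hIu, hdiv, hIp] with t h1 h2 h3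
      exact integral_mul_divergence_symmTestField h1 h2 h3 hK hKev (hψs t)
    rw [integral_congr_ae hae, integral_add J6a.integral_prod_left J6b.integral_prod_left,
      integral_prod _ J6a, integral_prod _ J6b]
  have eT : (∫ t in Ioo 0 T, ∫ x, ‖u t x‖ ^ 2 * FunctionSpaces.Torus.timeDeriv ψ t x) =
      ∫ z, ‖u z.1 z.2‖ ^ 2 * FunctionSpaces.Torus.timeDeriv ψ z.1 z.2 ∂μT := (integral_prod _ IT).symm
  have eA : (∫ t in Ioo 0 T, ∫ x, ‖u t x‖ ^ 2 * ⟪u t x, FunctionSpaces.Torus.gradient (ψ t) x⟫) =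
      ∫ z, ‖u z.1 z.2‖ ^ 2 * ⟪u z.1 z.2, FunctionSpaces.Torus.gradient (ψ z.1) z.2⟫ ∂μT :=
    (integral_prod _ IA).symm
  have eP : (∫ t in Ioo 0 T, ∫ x, p t x * ⟪u t x, FunctionSpaces.Torus.gradient (ψ t) x⟫) =
      ∫ z, p z.1 z.2 * ⟪u z.1 z.2, FunctionSpaces.Torus.gradient (ψ z.1) z.2⟫ ∂μT :=
    (integral_prod _ IP).symm
  -- the flux, split
  have eD : (∫ t in Ioo 0 T, ∫ x, (2⁻¹ * ‖u t x‖ ^ 2 * FunctionSpaces.Torus.timeDeriv ψ t x +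
        (2⁻¹ * ‖u t x‖ ^ 2 + p t x) * ⟪u t x, FunctionSpaces.Torus.gradient (ψ t) x⟫)) =
      2⁻¹ * (∫ z, ‖u z.1 z.2‖ ^ 2 * FunctionSpaces.Torus.timeDeriv ψ z.1 z.2 ∂μT) +
        (2⁻¹ * (∫ z, ‖u z.1 z.2‖ ^ 2 * ⟪u z.1 z.2, FunctionSpaces.Torus.gradient (ψ z.1) z.2⟫ ∂μT) +
          ∫ z, p z.1 z.2 * ⟪u z.1 z.2, FunctionSpaces.Torus.gradient (ψ z.1) z.2⟫ ∂μT) := by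
    have Icomb : Integrable (fun z : ℝ × UnitAddTorus d =>
        2⁻¹ * ‖u z.1 z.2‖ ^ 2 * FunctionSpaces.Torus.timeDeriv ψ z.1 z.2 +
          (2⁻¹ * ‖u z.1 z.2‖ ^ 2 + p z.1 z.2) * ⟪u z.1 z.2, FunctionSpaces.Torus.gradient (ψ z.1) z.2⟫) μT := by
      refine ((IT.const_mul 2⁻¹).add ((IA.const_mul 2⁻¹).add IP)).congr (ae_of_all _ fun z => ?_)
      simp only [Pi.add_apply]
      ring
    rw [← integral_prod _ Icomb]
    have hpt : ∀ z : ℝ × UnitAddTorus d,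
        2⁻¹ * ‖u z.1 z.2‖ ^ 2 * FunctionSpaces.Torus.timeDeriv ψ z.1 z.2 +
          (2⁻¹ * ‖u z.1 z.2‖ ^ 2 + p z.1 z.2) * ⟪u z.1 z.2, FunctionSpaces.Torus.gradient (ψ z.1) z.2⟫ =
        2⁻¹ * (‖u z.1 z.2‖ ^ 2 * FunctionSpaces.Torus.timeDeriv ψ z.1 z.2) +
          (2⁻¹ * (‖u z.1 z.2‖ ^ 2 * ⟪u z.1 z.2, FunctionSpaces.Torus.gradient (ψ z.1) z.2⟫) +
            p z.1 z.2 * ⟪u z.1 z.2, FunctionSpaces.Torus.gradient (ψ z.1) z.2⟫) := fun z => by ring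
    simp_rw [hpt]
    have K1 : Integrable (fun z : ℝ × UnitAddTorus d =>
        2⁻¹ * (‖u z.1 z.2‖ ^ 2 * FunctionSpaces.Torus.timeDeriv ψ z.1 z.2)) μT := IT.const_mul _
    have K2 : Integrable (fun z : ℝ × UnitAddTorus d =>
        2⁻¹ * (‖u z.1 z.2‖ ^ 2 * ⟪u z.1 z.2, FunctionSpaces.Torus.gradient (ψ z.1) z.2⟫) +
          p z.1 z.2 * ⟪u z.1 z.2, FunctionSpaces.Torus.gradient (ψ z.1) z.2⟫) μT := (IA.const_mul _).add IP
    have K2a : Integrable (fun z : ℝ × UnitAddTorus d =>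
        2⁻¹ * (‖u z.1 z.2‖ ^ 2 * ⟪u z.1 z.2, FunctionSpaces.Torus.gradient (ψ z.1) z.2⟫)) μT := IA.const_mul _
    rw [integral_add K1 K2, integral_add K2a IP, integral_const_mul, integral_const_mul]
  -- Step 5: the six term estimates
  have B1 : ∫⁻ z, ‖⟪vecConv (fun y => ‖u z.1 y‖ ^ 2 • u z.1 y) K z.2, FunctionSpaces.Torus.gradient (ψ z.1) z.2⟫ -
      ‖u z.1 z.2‖ ^ 2 * ⟪u z.1 z.2, FunctionSpaces.Torus.gradient (ψ z.1) z.2⟫‖ₑ ∂μT ≤ ENNReal.ofReal Cgr * Dw := by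
    calc _ ≤ ∫⁻ z, ENNReal.ofReal Cgr * ‖vecConv (fun y => ‖u z.1 y‖ ^ 2 • u z.1 y) K z.2 - ‖u z.1 z.2‖ ^ 2 • u z.1 z.2‖ₑ ∂μT := by
          refine lintegral_mono_ae (hGb.mono fun z hz => ?_)
          rw [← real_inner_smul_left, ← inner_sub_left, mul_comm]
          exact (enorm_inner_le_mul _ _).trans (mul_le_mul_right hz _)
      _ = ENNReal.ofReal Cgr * ∫⁻ z, ‖vecConv (fun y => ‖u z.1 y‖ ^ 2 • u z.1 y) K z.2 - ‖u z.1 z.2‖ ^ 2 • u z.1 z.2‖ₑ ^ (1 : ℝ) ∂μT := by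
          rw [lintegral_const_mul' _ _ hCg]; simp_rw [ENNReal.rpow_one]
      _ ≤ ENNReal.ofReal Cgr * Dw := by rw [hδw]; exact mul_le_mul_right hDw _
  have B2 : ∫⁻ z, ‖((fun y => ‖u z.1 y‖ ^ 2) ⋆ K) z.2 * ⟪u z.1 z.2, FunctionSpaces.Torus.gradient (ψ z.1) z.2⟫ -
      ‖u z.1 z.2‖ ^ 2 * ⟪u z.1 z.2, FunctionSpaces.Torus.gradient (ψ z.1) z.2⟫‖ₑ ∂μT ≤
      ENNReal.ofReal Cgr * (Ds ^ (2 / 3 : ℝ) * U3 ^ (1 / 3 : ℝ)) := by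
    calc _ ≤ ∫⁻ z, ENNReal.ofReal Cgr * (‖((fun y => ‖u z.1 y‖ ^ 2) ⋆ K) z.2 - ‖u z.1 z.2‖ ^ 2‖ₑ * ‖u z.1 z.2‖ₑ) ∂μT := by
          refine lintegral_mono_ae (hGb.mono fun z hz => ?_)
          rw [← sub_mul, enorm_mul]
          calc _ ≤ ‖((fun y => ‖u z.1 y‖ ^ 2) ⋆ K) z.2 - ‖u z.1 z.2‖ ^ 2‖ₑ * (‖u z.1 z.2‖ₑ * ENNReal.ofReal Cgr) := by
                gcongr; exact (enorm_inner_le_mul _ _).trans (mul_le_mul_right hz _)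
            _ = _ := by ring
      _ = ENNReal.ofReal Cgr * ∫⁻ z, ‖((fun y => ‖u z.1 y‖ ^ 2) ⋆ K) z.2 - ‖u z.1 z.2‖ ^ 2‖ₑ * ‖u z.1 z.2‖ₑ ∂μT :=
          lintegral_const_mul' _ _ hCg
      _ ≤ ENNReal.ofReal Cgr * (Ds ^ (2 / 3 : ℝ) * U3 ^ (1 / 3 : ℝ)) := by
          refine mul_le_mul_right ((lintegral_mul_le_L32_mul_L3 μT (hsKm.sub hsm).enorm hum.enorm).trans ?_) _
          exact mul_le_mul' (ENNReal.rpow_le_rpow (hδs.le.trans hDs) (by norm_num)) (ENNReal.rpow_le_rpow hU3 (by norm_num))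
  have B3 : ∫⁻ z, ‖⟪u z.1 z.2, vecConv (u z.1) K z.2⟫ * ⟪u z.1 z.2, FunctionSpaces.Torus.gradient (ψ z.1) z.2⟫ -
      ‖u z.1 z.2‖ ^ 2 * ⟪u z.1 z.2, FunctionSpaces.Torus.gradient (ψ z.1) z.2⟫‖ₑ ∂μT ≤
      ENNReal.ofReal Cgr * (U3 ^ (2 / 3 : ℝ) * Du3 ^ (1 / 3 : ℝ)) := by
    calc _ ≤ ∫⁻ z, ENNReal.ofReal Cgr * (‖u z.1 z.2‖ₑ ^ (2 : ℝ) * ‖vecConv (u z.1) K z.2 - u z.1 z.2‖ₑ) ∂μT := by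
          refine lintegral_mono_ae (hGb.mono fun z hz => ?_)
          rw [← sub_mul, ← real_inner_self_eq_norm_sq, ← inner_sub_right, enorm_mul]
          calc _ ≤ (‖u z.1 z.2‖ₑ * ‖vecConv (u z.1) K z.2 - u z.1 z.2‖ₑ) * (‖u z.1 z.2‖ₑ * ENNReal.ofReal Cgr) :=
                mul_le_mul' (enorm_inner_le_mul _ _) ((enorm_inner_le_mul _ _).trans (mul_le_mul_right hz _))
            _ = _ := by rw [ENNReal.rpow_two]; ring
      _ = ENNReal.ofReal Cgr * ∫⁻ z, ‖u z.1 z.2‖ₑ ^ (2 : ℝ) * ‖vecConv (u z.1) K z.2 - u z.1 z.2‖ₑ ∂μT :=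
          lintegral_const_mul' _ _ hCg
      _ ≤ ENNReal.ofReal Cgr * (U3 ^ (2 / 3 : ℝ) * Du3 ^ (1 / 3 : ℝ)) := by
          refine mul_le_mul_right ((lintegral_mul_le_L32_mul_L3 μT (hum.enorm.pow_const _) (huKm.sub hum).enorm).trans ?_) _
          refine mul_le_mul' (ENNReal.rpow_le_rpow ?_ (by norm_num)) (ENNReal.rpow_le_rpow (hδu3.le.trans hDu3) (by norm_num))
          calc ∫⁻ z, (‖uncurry u z‖ₑ ^ (2 : ℝ)) ^ (3 / 2 : ℝ) ∂μT = ∫⁻ z, ‖u z.1 z.2‖ₑ ^ (3 : ℝ) ∂μT :=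
                lintegral_congr fun z => rpow_two_rpow_threeHalves _
            _ ≤ U3 := hU3
  have B5 : ∫⁻ z, ‖⟪u z.1 z.2, vecConv (u z.1) K z.2⟫ * FunctionSpaces.Torus.timeDeriv ψ z.1 z.2 -
      ‖u z.1 z.2‖ ^ 2 * FunctionSpaces.Torus.timeDeriv ψ z.1 z.2‖ₑ ∂μT ≤
      ENNReal.ofReal Cdt * (U2 ^ (1 / 2 : ℝ) * Du2 ^ (1 / 2 : ℝ)) := by
    calc _ ≤ ∫⁻ z, ENNReal.ofReal Cdt * (‖u z.1 z.2‖ₑ * ‖vecConv (u z.1) K z.2 - u z.1 z.2‖ₑ) ∂μT := by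
          refine lintegral_mono_ae (hθb.mono fun z hz => ?_)
          rw [← sub_mul, ← real_inner_self_eq_norm_sq, ← inner_sub_right, enorm_mul]
          calc _ ≤ (‖u z.1 z.2‖ₑ * ‖vecConv (u z.1) K z.2 - u z.1 z.2‖ₑ) * ENNReal.ofReal Cdt :=
                mul_le_mul' (enorm_inner_le_mul _ _) hz
            _ = _ := by ring
      _ = ENNReal.ofReal Cdt * ∫⁻ z, ‖u z.1 z.2‖ₑ * ‖vecConv (u z.1) K z.2 - u z.1 z.2‖ₑ ∂μT :=
          lintegral_const_mul' _ _ hCd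
      _ ≤ ENNReal.ofReal Cdt * (U2 ^ (1 / 2 : ℝ) * Du2 ^ (1 / 2 : ℝ)) := by
          refine mul_le_mul_right ((lintegral_mul_le_sqrt_mul_sqrt μT hum.enorm (huKm.sub hum).enorm).trans ?_) _
          exact mul_le_mul' (ENNReal.rpow_le_rpow hU2 (by norm_num)) (ENNReal.rpow_le_rpow (hδu2.le.trans hDu2) (by norm_num))
  have B6 : ∫⁻ z, ‖p z.1 z.2 * ⟪vecConv (u z.1) K z.2, FunctionSpaces.Torus.gradient (ψ z.1) z.2⟫ -
      p z.1 z.2 * ⟪u z.1 z.2, FunctionSpaces.Torus.gradient (ψ z.1) z.2⟫‖ₑ ∂μT ≤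
      ENNReal.ofReal Cgr * (P ^ (2 / 3 : ℝ) * Du3 ^ (1 / 3 : ℝ)) := by
    calc _ ≤ ∫⁻ z, ENNReal.ofReal Cgr * (‖p z.1 z.2‖ₑ * ‖vecConv (u z.1) K z.2 - u z.1 z.2‖ₑ) ∂μT := by
          refine lintegral_mono_ae (hGb.mono fun z hz => ?_)
          rw [← mul_sub, ← inner_sub_left, enorm_mul]
          calc _ ≤ ‖p z.1 z.2‖ₑ * (‖vecConv (u z.1) K z.2 - u z.1 z.2‖ₑ * ENNReal.ofReal Cgr) := by
                gcongr; exact (enorm_inner_le_mul _ _).trans (mul_le_mul_right hz _)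
            _ = _ := by ring
      _ = ENNReal.ofReal Cgr * ∫⁻ z, ‖p z.1 z.2‖ₑ * ‖vecConv (u z.1) K z.2 - u z.1 z.2‖ₑ ∂μT :=
          lintegral_const_mul' _ _ hCg
      _ ≤ ENNReal.ofReal Cgr * (P ^ (2 / 3 : ℝ) * Du3 ^ (1 / 3 : ℝ)) := by
          refine mul_le_mul_right ((lintegral_mul_le_L32_mul_L3 μT hpm.enorm (huKm.sub hum).enorm).trans ?_) _
          exact mul_le_mul' (ENNReal.rpow_le_rpow hP (by norm_num)) (ENNReal.rpow_le_rpow (hδu3.le.trans hDu3) (by norm_num))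
  have B6' : ∫⁻ z, ‖(p z.1 ⋆ K) z.2 * ⟪u z.1 z.2, FunctionSpaces.Torus.gradient (ψ z.1) z.2⟫ -
      p z.1 z.2 * ⟪u z.1 z.2, FunctionSpaces.Torus.gradient (ψ z.1) z.2⟫‖ₑ ∂μT ≤
      ENNReal.ofReal Cgr * (Dp ^ (2 / 3 : ℝ) * U3 ^ (1 / 3 : ℝ)) := by
    calc _ ≤ ∫⁻ z, ENNReal.ofReal Cgr * (‖(p z.1 ⋆ K) z.2 - p z.1 z.2‖ₑ * ‖u z.1 z.2‖ₑ) ∂μT := by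
          refine lintegral_mono_ae (hGb.mono fun z hz => ?_)
          rw [← sub_mul, enorm_mul]
          calc _ ≤ ‖(p z.1 ⋆ K) z.2 - p z.1 z.2‖ₑ * (‖u z.1 z.2‖ₑ * ENNReal.ofReal Cgr) := by
                gcongr; exact (enorm_inner_le_mul _ _).trans (mul_le_mul_right hz _)
            _ = _ := by ring
      _ = ENNReal.ofReal Cgr * ∫⁻ z, ‖(p z.1 ⋆ K) z.2 - p z.1 z.2‖ₑ * ‖u z.1 z.2‖ₑ ∂μT :=
          lintegral_const_mul' _ _ hCg
      _ ≤ ENNReal.ofReal Cgr * (Dp ^ (2 / 3 : ℝ) * U3 ^ (1 / 3 : ℝ)) := by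
          refine mul_le_mul_right ((lintegral_mul_le_L32_mul_L3 μT (hpKm.sub hpm).enorm hum.enorm).trans ?_) _
          exact mul_le_mul' (ENNReal.rpow_le_rpow (hδp.le.trans hDp) (by norm_num)) (ENNReal.rpow_le_rpow hU3 (by norm_num))
  -- conclusion
  rw [key, e1, e2, e3, e5, e6, eD, zero_mul, add_zero]
  have hdiff : ∀ a₁ a₂ a₃ a₅ a₆ a₆' a₀ t₀ p₀ : ℝ,
      4⁻¹ * ((a₁ - a₂ + 2 * a₃) + 2 * (a₅ + (a₆ + a₆'))) - (2⁻¹ * t₀ + (2⁻¹ * a₀ + p₀)) =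
        4⁻¹ * (((a₁ - a₀) - (a₂ - a₀) + 2 * (a₃ - a₀)) + 2 * ((a₅ - t₀) + ((a₆ - p₀) + (a₆' - p₀)))) :=
    fun _ _ _ _ _ _ _ _ _ => by ring
  rw [hdiff]
  refine (ENNReal.ofReal_le_ofReal (abs_quarter_comb_le _ _ _ _ _ _)).trans ?_
  rw [ofReal_quarter_comb _ _ _ _ _ _ (abs_nonneg _) (abs_nonneg _) (abs_nonneg _) (abs_nonneg _)
    (abs_nonneg _) (abs_nonneg _)]
  gcongr
  · exact (ofReal_abs_integral_sub_integral_le J1 IA).trans B1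
  · exact (ofReal_abs_integral_sub_integral_le J2 IA).trans B2
  · exact (ofReal_abs_integral_sub_integral_le J3 IA).trans B3
  · exact (ofReal_abs_integral_sub_integral_le J5 IT).trans B5
  · exact (ofReal_abs_integral_sub_integral_le J6a IP).trans B6
  · exact (ofReal_abs_integral_sub_integral_le J6b IP).trans B6' 

end ScaleEstimate

/-! ## Uniform defects of weak Euler solutions, and the 4/3 law -/

section Main

variable [DecidableEq d] {T : ℝ} {u : ℝ → UnitAddTorus d → EuclideanSpace ℝ d} {p : ℝ → UnitAddTorus d → ℝ}

/-- The bound of `ofReal_abs_duchonRobert_sub_flux_le` with all deviations equal to `τ` tends to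
`0` with `τ` (finite fixed norms). [folklore] -/
theorem tendsto_scaleBound {Cdt Cgr : ℝ} {U3 U2 P : ℝ≥0∞} (hU3t : U3 ≠ ⊤) (hU2t : U2 ≠ ⊤) (hPt : P ≠ ⊤) :
    Tendsto (fun τ : ℝ≥0∞ =>
      4⁻¹ * (ENNReal.ofReal Cgr * τ + ENNReal.ofReal Cgr * (τ ^ (2 / 3 : ℝ) * U3 ^ (1 / 3 : ℝ)) +
        2 * (ENNReal.ofReal Cgr * (U3 ^ (2 / 3 : ℝ) * τ ^ (1 / 3 : ℝ))) +
        2 * (ENNReal.ofReal Cdt * (U2 ^ (1 / 2 : ℝ) * τ ^ (1 / 2 : ℝ)) +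
          (ENNReal.ofReal Cgr * (P ^ (2 / 3 : ℝ) * τ ^ (1 / 3 : ℝ)) +
            ENNReal.ofReal Cgr * (τ ^ (2 / 3 : ℝ) * U3 ^ (1 / 3 : ℝ)))))) (𝓝 0) (𝓝 0) := by
  have hr : ∀ {r : ℝ}, 0 < r → Tendsto (fun τ : ℝ≥0∞ => τ ^ r) (𝓝 0) (𝓝 0) := fun {r} hr => by
    have := (ENNReal.continuous_rpow_const (y := r)).tendsto 0
    rwa [ENNReal.zero_rpow_of_pos hr] at this
  have hfin : ∀ {x : ℝ≥0∞} {r : ℝ}, 0 ≤ r → x ≠ ⊤ → x ^ r ≠ ⊤ := fun hr hx => ENNReal.rpow_ne_top_of_nonneg hr hx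
  -- generic pieces `c * (τ^r * a)` and `c * (a * τ^r)` with finite `c`, `a`
  have piece1 : ∀ {c a : ℝ≥0∞} {r : ℝ}, c ≠ ⊤ → a ≠ ⊤ → 0 < r →
      Tendsto (fun τ : ℝ≥0∞ => c * (τ ^ r * a)) (𝓝 0) (𝓝 0) := fun {c a r} hc ha hr0 => by
    have h1 := ENNReal.Tendsto.mul_const (hr hr0) (Or.inr ha) (b := a)
    rw [zero_mul] at h1
    have h2 := ENNReal.Tendsto.const_mul h1 (Or.inr hc) (a := c)
    rwa [mul_zero] at h2
  have piece2 : ∀ {c a : ℝ≥0∞} {r : ℝ}, c ≠ ⊤ → a ≠ ⊤ → 0 < r →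
      Tendsto (fun τ : ℝ≥0∞ => c * (a * τ ^ r)) (𝓝 0) (𝓝 0) := fun {c a r} hc ha hr0 => by
    simpa only [mul_comm a] using piece1 hc ha hr0
  have piece0 : ∀ {c : ℝ≥0∞}, c ≠ ⊤ → Tendsto (fun τ : ℝ≥0∞ => c * τ) (𝓝 0) (𝓝 0) := fun {c} hc => by
    have := ENNReal.Tendsto.const_mul (tendsto_id (x := 𝓝 (0 : ℝ≥0∞))) (Or.inr hc) (a := c)
    rwa [mul_zero] at this
  have hCg : ENNReal.ofReal Cgr ≠ ⊤ := ENNReal.ofReal_ne_top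
  have hCd : ENNReal.ofReal Cdt ≠ ⊤ := ENNReal.ofReal_ne_top
  have hU3a : U3 ^ (1 / 3 : ℝ) ≠ ⊤ := hfin (by norm_num) hU3t
  have hU3b : U3 ^ (2 / 3 : ℝ) ≠ ⊤ := hfin (by norm_num) hU3t
  have hU2a : U2 ^ (1 / 2 : ℝ) ≠ ⊤ := hfin (by norm_num) hU2t
  have hPa : P ^ (2 / 3 : ℝ) ≠ ⊤ := hfin (by norm_num) hPt
  have t1 : Tendsto (fun τ : ℝ≥0∞ => ENNReal.ofReal Cgr * τ) (𝓝 0) (𝓝 0) := piece0 hCg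
  have t2 : Tendsto (fun τ : ℝ≥0∞ => ENNReal.ofReal Cgr * (τ ^ (2 / 3 : ℝ) * U3 ^ (1 / 3 : ℝ))) (𝓝 0) (𝓝 0) :=
    piece1 hCg hU3a (by norm_num)
  have t3 : Tendsto (fun τ : ℝ≥0∞ => 2 * (ENNReal.ofReal Cgr * (U3 ^ (2 / 3 : ℝ) * τ ^ (1 / 3 : ℝ)))) (𝓝 0) (𝓝 0) := by
    have := ENNReal.Tendsto.const_mul (piece2 hCg hU3b (by norm_num : (0 : ℝ) < 1 / 3)) (Or.inr ENNReal.ofNat_ne_top)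
      (a := (2 : ℝ≥0∞))
    rwa [mul_zero] at this
  have t5 : Tendsto (fun τ : ℝ≥0∞ => ENNReal.ofReal Cdt * (U2 ^ (1 / 2 : ℝ) * τ ^ (1 / 2 : ℝ))) (𝓝 0) (𝓝 0) :=
    piece2 hCd hU2a (by norm_num)
  have t6 : Tendsto (fun τ : ℝ≥0∞ => ENNReal.ofReal Cgr * (P ^ (2 / 3 : ℝ) * τ ^ (1 / 3 : ℝ))) (𝓝 0) (𝓝 0) :=
    piece2 hCg hPa (by norm_num)
  have t7 : Tendsto (fun τ : ℝ≥0∞ => ENNReal.ofReal Cgr * (τ ^ (2 / 3 : ℝ) * U3 ^ (1 / 3 : ℝ))) (𝓝 0) (𝓝 0) :=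
    piece1 hCg hU3a (by norm_num)
  have t567 : Tendsto (fun τ : ℝ≥0∞ => 2 * (ENNReal.ofReal Cdt * (U2 ^ (1 / 2 : ℝ) * τ ^ (1 / 2 : ℝ)) +
      (ENNReal.ofReal Cgr * (P ^ (2 / 3 : ℝ) * τ ^ (1 / 3 : ℝ)) +
        ENNReal.ofReal Cgr * (τ ^ (2 / 3 : ℝ) * U3 ^ (1 / 3 : ℝ))))) (𝓝 0) (𝓝 0) := by
    have h := t5.add (t6.add t7)
    simp only [add_zero] at h
    have := ENNReal.Tendsto.const_mul h (Or.inr ENNReal.ofNat_ne_top) (a := (2 : ℝ≥0∞))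
    rwa [mul_zero] at this
  have hsum := ((t1.add t2).add t3).add t567
  simp only [add_zero] at hsum
  have := ENNReal.Tendsto.const_mul hsum (Or.inr (ENNReal.inv_ne_top.2 (by norm_num))) (a := (4⁻¹ : ℝ≥0∞))
  rwa [mul_zero] at this

set_option maxHeartbeats 800000 in
/-- **Weak Euler solutions have uniform Duchon–Robert defects** (granted Duchon–Robert's cubic
identity and tested momentum equation, `DuchonRobertLocalBalance`). For a distributional Euler
solution `(u, p)` on `T^d × (0,T)` with `u ∈ L³`, `p ∈ L^{3/2}`, the Duchon–Robert fluxes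
`∫₀ᵀ∫ D_ε^φ(u) ψ` converge as `ε → 0⁺` to the local energy flux
`∫₀ᵀ∫ [½|u|²∂ₜψ + (½|u|² + p)⟪u,∇ψ⟫]` **uniformly over unit-ball mollifiers `φ`**
(`Torus.HasUniformDuchonRobertDefect`): by `ofReal_abs_duchonRobert_sub_flux_le` the error is
controlled by the kernel-average deviations of `u`, `|u|²`, `|u|²u`, `p` in `L³`, `L²`,
`L^{3/2}`, `L¹`, which are small uniformly in `φ` (continuity of translation,
`exists_forall_lintegral_kernelAverage_sub_rpow_le`). This is the uniformity implicit in
Duchon–Robert 2000, proof of Prop. 2, and Eyink 2003, §2. [folklore] -/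
theorem hasUniformDuchonRobertDefect_of_steps
    (hAlg : integral_kernelFlux_mul_eq (d := d))
    (hEq : IsDistributionalNSSolutionOn.symmTestField_identity (d := d))
    (hsol : IsDistributionalNSSolutionOn T 0 0 u p)
    (hu3 : ∫⁻ t in Ioo 0 T, ∫⁻ x, ‖u t x‖ₑ ^ 3 < ⊤)
    (hp : ∫⁻ t in Ioo 0 T, ∫⁻ x, ‖p t x‖ₑ ^ (3 / 2 : ℝ) < ⊤) :
    HasUniformDuchonRobertDefect T u (fun ψ => ∫ t in Ioo 0 T, ∫ x,
      (2⁻¹ * ‖u t x‖ ^ 2 * FunctionSpaces.Torus.timeDeriv ψ t x +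
        (2⁻¹ * ‖u t x‖ ^ 2 + p t x) * ⟪u t x, FunctionSpaces.Torus.gradient (ψ t) x⟫)) := by
  refine hasUniformDuchonRobertDefect_of_forall_exists fun ψ hψ η hη => ?_
  set μT := (volume.restrict (Ioo 0 T)).prod (volume : Measure (UnitAddTorus d)) with hμT
  have hum : AEStronglyMeasurable (uncurry u) μT := aestronglyMeasurable_uncurry_prod hsol.1
  have hpm : AEStronglyMeasurable (uncurry p) μT := aestronglyMeasurable_uncurry_prod hsol.2.2.1
  obtain ⟨-, hdt, hgr, -⟩ := hψ.isSpaceTimeTest.isSmoothSpaceTimeOn_derived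
  obtain ⟨⟨Cdt, -, hCdt⟩, -⟩ := hdt.bound_and_measurable T
  obtain ⟨⟨Cgr, -, hCgr⟩, -⟩ := hgr.bound_and_measurable T
  -- the fixed finite quantities
  have hU3t : ∫⁻ z, ‖u z.1 z.2‖ₑ ^ (3 : ℝ) ∂μT < ⊤ := by
    have e3 : ∫⁻ t in Ioo 0 T, ∫⁻ x, ‖u t x‖ₑ ^ (3 : ℕ) = ∫⁻ z, ‖u z.1 z.2‖ₑ ^ (3 : ℕ) ∂μT :=
      lintegral_Ioo_lintegral_eq_lintegral_prod (g := fun t x => ‖u t x‖ₑ ^ (3 : ℕ)) (hum.enorm.pow_const _)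
    simp_rw [rpow_three_eq_pow]
    rw [← e3]
    exact hu3
  have hU2t : ∫⁻ z, ‖u z.1 z.2‖ₑ ^ (2 : ℝ) ∂μT < ⊤ := by
    have e2 : ∫⁻ t in Ioo 0 T, ∫⁻ x, ‖u t x‖ₑ ^ (2 : ℕ) = ∫⁻ z, ‖u z.1 z.2‖ₑ ^ (2 : ℕ) ∂μT :=
      lintegral_Ioo_lintegral_eq_lintegral_prod (g := fun t x => ‖u t x‖ₑ ^ (2 : ℕ)) (hum.enorm.pow_const _)
    simp_rw [ENNReal.rpow_two]
    rw [← e2]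
    exact hsol.2.1
  have hPt : ∫⁻ z, ‖p z.1 z.2‖ₑ ^ (3 / 2 : ℝ) ∂μT < ⊤ := by
    have e := lintegral_Ioo_lintegral_eq_lintegral_prod (g := fun t x => ‖p t x‖ₑ ^ (3 / 2 : ℝ))
      (hpm.enorm.pow_const _)
    rw [← e]
    exact hp
  have hsm : AEStronglyMeasurable (uncurry fun t x => ‖u t x‖ ^ 2) μT := hum.norm.pow 2
  have hwm : AEStronglyMeasurable (uncurry fun t x => ‖u t x‖ ^ 2 • u t x) μT := hsm.smul hum
  have hS : ∫⁻ z, ‖uncurry (fun t x => ‖u t x‖ ^ 2) z‖ₑ ^ (3 / 2 : ℝ) ∂μT < ⊤ := by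
    refine lt_of_le_of_lt (le_of_eq (lintegral_congr fun z => ?_)) hU3t
    simp only [uncurry]
    rw [enorm_norm_pow, ← ENNReal.rpow_two, rpow_two_rpow_threeHalves]
  have hW : ∫⁻ z, ‖uncurry (fun t x => ‖u t x‖ ^ 2 • u t x) z‖ₑ ^ (1 : ℝ) ∂μT < ⊤ := by
    refine lt_of_le_of_lt (le_of_eq (lintegral_congr fun z => ?_)) hU3t
    simp only [uncurry]
    rw [ENNReal.rpow_one, enorm_norm_sq_smul, rpow_three_eq_pow]
  -- choose the common deviation size `τ`
  have hΨ := tendsto_scaleBound (Cdt := Cdt) (Cgr := Cgr) hU3t.ne hU2t.ne hPt.ne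
  have hη' : (0 : ℝ≥0∞) < ENNReal.ofReal η := ENNReal.ofReal_pos.2 hη
  obtain ⟨a, ha0, ha⟩ := ENNReal.nhds_zero_basis.eventually_iff.1 (hΨ.eventually (gt_mem_nhds hη'))
  obtain ⟨τ, hτ0, hτa⟩ : ∃ τ : ℝ≥0∞, 0 < τ ∧ τ < a := by
    by_cases hat : a = ⊤
    · exact ⟨1, one_pos, hat ▸ ENNReal.one_lt_top⟩
    · exact ⟨a / 2, ENNReal.half_pos ha0.ne', ENNReal.half_lt_self ha0.ne' hat⟩
  have hΨτ := ha hτa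
  -- the five mollification thresholds
  obtain ⟨ε₁, hε₁, H1⟩ := exists_forall_lintegral_kernelAverage_sub_rpow_le (T := T) hum (q := 3) (by norm_num) hU3t hτ0
  obtain ⟨ε₂, hε₂, H2⟩ := exists_forall_lintegral_kernelAverage_sub_rpow_le (T := T) hum (q := 2) (by norm_num) hU2t hτ0
  obtain ⟨ε₃, hε₃, H3⟩ := exists_forall_lintegral_kernelAverage_sub_rpow_le (T := T) hsm (q := 3 / 2) (by norm_num) hS hτ0
  obtain ⟨ε₄, hε₄, H4⟩ := exists_forall_lintegral_kernelAverage_sub_rpow_le (T := T) hwm (q := 1) le_rfl hW hτ0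
  obtain ⟨ε₅, hε₅, H5⟩ := exists_forall_lintegral_kernelAverage_sub_rpow_le (T := T) hpm (q := 3 / 2) (by norm_num) hPt hτ0
  refine ⟨min (min (min ε₁ ε₂) (min ε₃ ε₄)) ε₅, by positivity, fun φ hφ ε hε => ?_⟩
  have hε0 : 0 < ε := hε.1
  have hlt : ε < min (min (min ε₁ ε₂) (min ε₃ ε₄)) ε₅ := hε.2
  have h1 : ε ∈ Ioo 0 ε₁ := ⟨hε0, hlt.trans_le ((min_le_left _ _).trans ((min_le_left _ _).trans (min_le_left _ _)))⟩
  have h2 : ε ∈ Ioo 0 ε₂ := ⟨hε0, hlt.trans_le ((min_le_left _ _).trans ((min_le_left _ _).trans (min_le_right _ _)))⟩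
  have h3 : ε ∈ Ioo 0 ε₃ := ⟨hε0, hlt.trans_le ((min_le_left _ _).trans ((min_le_right _ _).trans (min_le_left _ _)))⟩
  have h4 : ε ∈ Ioo 0 ε₄ := ⟨hε0, hlt.trans_le ((min_le_left _ _).trans ((min_le_right _ _).trans (min_le_right _ _)))⟩
  have h5 : ε ∈ Ioo 0 ε₅ := ⟨hε0, hlt.trans_le (min_le_right _ _)⟩
  have hA := ofReal_abs_duchonRobert_sub_flux_le hAlg hEq hsol hu3 hp hψ hCdt hCgr hφ hε0
    hU3t.ne hU2t.ne hPt.ne le_rfl le_rfl le_rfl (H1 φ hφ ε h1) (H2 φ hφ ε h2) (H3 φ hφ ε h3)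
    (H4 φ hφ ε h4) (H5 φ hφ ε h5)
  exact (ENNReal.ofReal_lt_ofReal_iff hη).1 (lt_of_le_of_lt hA hΨτ)

omit [DecidableEq d] in
/-- **The accepted fact `HasDuchonRobertDefect.hasFourThirdsLaw` from printed ingredients.** The
unconditional local 4/3 law for `L³` weak Euler solutions follows from
(i) Duchon–Robert's cubic identity `Torus.integral_kernelFlux_mul_eq`,
(ii) the tested momentum equation `Torus.IsDistributionalNSSolutionOn.symmTestField_identity`
(both Duchon–Robert 2000, proof of Prop. 1–2, `DuchonRobertLocalBalance`), and
(iii) the pressure fact `Torus.exists_pressure_of_tendsto_L3` (Calderón–Zygmund on `T^d`,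
`DuchonRobertInviscidLimit`): the pressure makes the pressure-free weak solution distributional,
(i)–(ii) give a uniform Duchon–Robert defect (`hasUniformDuchonRobertDefect_of_steps`), and a
uniform defect yields the shell limit (`hasFourThirdsLaw_of_forall_hasUniformDuchonRobertDefect`,
`DuchonRobertUniformDefect`). [folklore] -/
theorem hasFourThirdsLaw_of_steps
    (hAlg : ∀ [DecidableEq d], integral_kernelFlux_mul_eq (d := d))
    (hEq : ∀ [DecidableEq d], IsDistributionalNSSolutionOn.symmTestField_identity (d := d))
    (hA1 : exists_pressure_of_tendsto_L3 (T := T) (u := u)) :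
    HasDuchonRobertDefect.hasFourThirdsLaw (T := T) (u := u) := by
  refine hasFourThirdsLaw_of_forall_hasUniformDuchonRobertDefect fun {_} {D} _ hE hu3 => ?_
  have hconv : Tendsto (fun _ : ℕ => ∫⁻ t in Ioo 0 T, ∫⁻ x, ‖u t x - u t x‖ₑ ^ (3 : ℕ)) atTop (𝓝 0) := by
    simp only [sub_self, enorm_zero, ne_eq, OfNat.ofNat_ne_zero, not_false_eq_true, zero_pow,
      lintegral_const, zero_mul]
    exact tendsto_const_nhds
  obtain ⟨_, p, -, hdist, hp32, -⟩ := hA1 (νseq := fun _ => 0) (ν := 0) (useq := fun _ => u)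
    (Eventually.of_forall fun _ => hE) hE hconv hu3
  exact ⟨_, hasUniformDuchonRobertDefect_of_steps hAlg hEq hdist hu3 hp32⟩

omit [DecidableEq d] in
/-- **The 4/3 law, conditional on the tested momentum equation and the pressure fact only.** With
Duchon–Robert's cubic identity discharged (`Torus.integral_kernelFlux_mul_eq_holds`,
`DuchonRobertCubicIdentity`), the accepted fact `Torus.HasDuchonRobertDefect.hasFourThirdsLaw`
follows from the tested momentum equation `Torus.IsDistributionalNSSolutionOn.symmTestField_identity`
and the pressure fact `Torus.exists_pressure_of_tendsto_L3`. [folklore] -/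
theorem hasFourThirdsLaw_of_symmTestField_identity_of_pressure
    (hEq : ∀ [DecidableEq d], IsDistributionalNSSolutionOn.symmTestField_identity (d := d))
    (hA1 : exists_pressure_of_tendsto_L3 (T := T) (u := u)) :
    HasDuchonRobertDefect.hasFourThirdsLaw (T := T) (u := u) :=
  hasFourThirdsLaw_of_steps (fun {_} => integral_kernelFlux_mul_eq_holds) hEq hA1

end Main

end Literature.Analysis.FluidPDE.Torus
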